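import Literature.MathematicalPhysics.QuantumFieldTheory.Balaban1983to89.B5Prop12GHolds

/-!
# `Balaban1983to89.B5Remark36Derivatives` — Bałaban CMP 95 (1984), the remark after (1.114) on p. 36: in (1.112), (1.113) «the
# choice of derivatives ∇G∇* is accidental; we can take arbitrary derivatives, like ∂_μG∂_ν, ∂*_μG∂_ν, ∂*_μG∂*_ν» — PROVED for the
# G-family of record `B5Prop12GLattice.famG d L a` (Bałaban's `G = Δ_a⁻¹` on the tori `T_η`), from Proposition 1.2 for that family

statement-level skeleton of published theorems with citation tags; proofs where landed; nothing here is a claim about the Yang–Mills mass gap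

CITATION HEADER.  T. Bałaban, *Propagators and renormalization transformations for lattice gauge theories. I*, Commun. Math.
Phys. **95** (1984) 17–40 [`Balaban1984PropagatorsI`, "B5" of the series], p. 36 [PDF 20] (PDF held as
`paper:balaban1984-cmp95-propagators-rt-i`; the page READ AS IMAGE this session on the ×2 render
`run/shared/lean/pub/pub-balaban/b2b-balaban-ref1/pages/1984-cmp95-propagators-rt-I/1984-cmp95-propagators-rt-I-p020-x2.png`, text layer
p0019/p0020 grepped).  Cell `lit-balaban` (HOME `run/shared/lean/pub/lit-balaban/`), reader/typer seat **r02** gen 8 (the B5 block owner,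
`literature-prover-lit-balaban-r02-g8-0`); SKELETON row **B5.Txt@36** (NEW, born with this file; agreed with p37 gen 8, HOME/STATUS
2026-08-21T21:21Z / 22:55Z), cells on B5.Prop1.2.  Inputs BY NAME, not restated: p37 g7's `B5Prop12GHolds.prop12_famG_printed`
(Proposition 1.2 (1.110)–(1.114) for `famG d L a`, hypothesis-free), r02 g5's concrete Prop-1.2 carrier `B5Prop12FieldsLattice`
(`cubeT` = Δ̃(y), `distU`, `distSite`, `suppInL`, `supNormL`, `holderL`/`holderT`, `cutInL`, `cutHL`, `smulT`, the printed entries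
`e4L` (1.112), `h2L` (1.113)), r02 g5's unit-scale partition `B5CoverP12Lattice.wP` ((1.118) profile squared at scale one, `sum_wP`,
`abs_wP_sub_le`) and pieces `B5GlobCoverP12Lattice.pieceL` (`piece_supp`, `piece_sup`, `piece_holder`, `sum_pieces_ten`), the
lattice calculus `B5Prop11Plancherel.fdiff`/`shiftM`, `B5Prop11Lattice.grad`/`divT`, `B5CombesThomasLattice.fdiff_apply`,
`B5Local114GLatticeSecond.fdiffH_apply`.

WHAT IS PRINTED (p. 36 [PDF 20], verbatim).  After (1.112) *"|(∇G∇*J)(x)| ≤ O(1)e^{−δ₀|y−y′|}(‖J‖_ε + |J|) (1.112) for 0 < ε < 1,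
x ∈ Δ̃(y), supp J ⊂ Δ̃(y′), with the constant O(1) depending on d and ε"*, (1.113) *"‖ζ∇G∇*J‖_α ≤ O(1)e^{−δ₀|y−y′|}(‖ζ‖_α + |ζ|)
(‖J‖_{α+ε} + |J|) (1.113) for 0 ≤ α < 1, ε > 0, α + ε < 1, ζ ∈ C₀^∞(Δ̃(y)), supp J ⊂ Δ̃(y′)"* and (1.114):
*"**Let us remark that in the inequalities (1.112), (1.113) the choice of derivatives ∇G∇\* is accidental; we can take arbitrary
derivatives, like ∂_μG∂_ν, ∂\*_μG∂_ν, ∂\*_μG∂\*_ν.**"*  No proof or further comment is printed (the proof of Prop. 1.2, pp. 36–40, treats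
`∇G∇*` only; p. 39: *"The proofs of the other inequalities are exactly the same"* refers to the entries of (1.110)–(1.114)).  Here `∂_μ`
is the forward lattice derivative and `∂*_μ` its adjoint ((1.21) p. 21: *"⟨∂A, ∂A⟩ = … − ⟨∂*A, ∂*A⟩"*; `∇* = Σ_ν ∂*_ν` in (1.89)/(1.112)).

WHAT THIS MODULE PROVES (kernel-checked, 0 `sorry`, axioms `propext`/`Classical.choice`/`Quot.sound`; the six `def`s have bodies,
NO `Prop`-valued fact is introduced).
* §1 `dK s ν` (the derivative of kind `s`: `true ↦ ∂_ν = fdiff`, `false ↦ ∂_ν^* = star fdiff`), the generalised divergence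
  `gdiv s₂ J = Σ_ν D^{s₂ν}_ν J_ν`, gradient `ggrad s₁ A = (D^{s₁μ}_μ A)_μ`, the field `fieldG s₁ s₂ J = D₁GD₂J` (`G = (DeltaA n M a)⁻¹`)
  and its two entries **`e4G s₁ s₂ J y = sup_{x∈Δ̃(y)}|(D₁GD₂J)(x)|`**, **`h2G s₁ s₂ J α ζ = ‖ζD₁GD₂J‖_α`**; sanity `e4G_true_false` /
  `h2G_true_false`: with `D₁ = ∇`, `D₂ = ∇*` they ARE the printed entries `e4L`/`h2L` of the setting of record (by `rfl`).
* §2 the inner conversion **`∂_ν v = ∂_ν^*(−S_ν v)`** (`fdiff_mulVec_eq_star_mulVec_neg_shift`; `(S_νv)(x) = v(x + e_ν)`), hence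
  **`gdiv_eq_divT_sharp`**: `Σ_ν D_νJ_ν = ∇*J♯` with the translated source `sharp` (`J♯_ν = −S_νJ_ν` on forward components).
* §3 `J♯`: support one fine step around `Δ̃(y′)` (`sharp_supp`), `|J♯| ≤ |J|`, `‖J♯‖_ε ≤ ‖J‖_ε` (translation invariance of (1.108)/
  (1.109): `distU_add_right`); cube geometry: `x ∈ Δ̃(y)`, `x′ ∈ Δ̃(w)` ⇒ `|y − w| ≤ |x − x′| + 2` (`distSite_le_distU_add_two`), one
  fine step ⇒ `|y − w| ≤ 3`, `#{w : |y − w| ≤ 3} ≤ 7^d` (`card_near_le`).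
* §4 the outer conversion, sup entry: **`(∂_μ^*A)(x) = −(∂_μA)(x − e_μ)`** (`star_fdiff_mulVec_apply`) and **`sup_ggrad_le`**: if the
  printed entries of a source `K` obey `sup_{Δ̃(y₁)}|∇G∇*K| ≤ Ce^{−δ₀|y₁−w|}N` for all labels `y₁`, then `sup_{Δ̃(y)}|D₁G∇*K| ≤
  Ce^{3δ₀}e^{−δ₀|y−w|}N` (`x − e_μ ∈ Δ̃(y₁)` with `|y₁ − y| ≤ 3`).
* §5 the outer conversion, Hölder entry: `ζ·∂_μ^*A = −S_μ^{−1}[(S_μζ)·∂_μA]`, the translated cut-off re-localised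
  `S_μζ = Σ_{y₁} ζ′_{y₁}S_μζ` (`locCut`, `smulT_eq_sum_locCut`), `supp ζ′_{y₁}S_μζ ⊂ Δ̃(y₁)`, `‖ζ′_{y₁}ξ‖_α + |ζ′_{y₁}ξ| ≤
  (1 + L_w)(‖ξ‖_α + |ξ|)` (`cutHL_locCut_le`), `‖S_μζ‖_α + |S_μζ| ≤ ‖ζ‖_α + |ζ|`, and **`holder_ggrad_le`**: the (1.113)-type bound for
  `ζD₁G∇*K` with constant `7^d(1 + L_w)Ce^{3δ₀}`.
* §6 real sources (`embT`, `emb_ten`: the sources of `famG` are real), the pieces `ζ′_wJ♯` are real sources supported in `Δ̃(w)` and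
  vanish unless `|w − y′| ≤ 3` (`piece_sharp_eq_zero_of_far`), and the assembled one-torus theorems **`e4G_le`**, **`h2G_le`**: from
  the printed (1.112) resp. (1.113) FOR ALL REAL TENSOR SOURCES on a torus with `≥ 2` unit cubes per direction follow the same
  bounds for `D₁GD₂J` with constants `7^d(max(1,L_w)+1)Ce^{6δ₀}` resp. `49^d(1+L_w)(max(1,L_w)+1)Ce^{6δ₀}` and the SAME `δ₀`.
* §7 **`remark36_famG`**: for `famG d L a` (`d ≥ 1`, `L > 1` odd, `a > 0`) there are `δ₀ > 0`, `C_ε ≥ 0`, `C_{α,ε} ≥ 0`, chosen before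
  the member, with, for every member, every `s₁, s₂ : Fin d → Bool` and every real tensor source `J`, `supp J ⊂ Δ̃(y′)`:
  `sup_{x∈Δ̃(y)}|(D₁GD₂J)(x)| ≤ C_ε e^{−δ₀|y−y′|}(‖J‖_ε + |J|)` (`0 < ε < 1`) and `‖ζD₁GD₂J‖_α ≤ C_{α,ε}e^{−δ₀|y−y′|}(‖ζ‖_α + |ζ|)
  (‖J‖_{α+ε} + |J|)` (`0 ≤ α`, `0 < ε`, `α + ε < 1`, `supp ζ ⊂ Δ̃(y)`) — from `B5Prop12GHolds.prop12_famG_printed`.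

THE ARGUMENT (ours — the print gives none).  No property of `G` is used beyond (1.112)/(1.113) themselves: the lattice identities
`∂_ν = −∂_ν^*S_ν = −S_ν∂_ν^*` (`S_ν` the translation by one FINE step, commuting with `∂`, `∂*`) move a forward inner derivative onto a
translated source and an adjoint outer derivative onto a translated output point / translated cut-off; translation by one fine step
(≤ one unit) preserves `|·|`, `‖·‖_ε`, `‖·‖_α` and moves `Δ̃`-localisations to neighbouring labels (`|y₁ − y| ≤ 3`, factor `e^{3δ₀}`,
at most `7^d` labels); sources and cut-offs that are no longer inside ONE doubled cube are re-localised with r02 g5's unit-scale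
Lipschitz partition `ζ′_w = wP w` (the (1.118) profile squared at scale one), which costs `‖ζ′_wF‖_ε ≤ max(1, L_w)(‖F‖_ε + |F|)`.

DICTIONARY (print ↦ Lean).  `∂_μ` ↦ `fdiff (fine n M) (n : ℂ) μ` ((1.31), `B5Prop11Plancherel`); `∂*_μ` ↦ `star (fdiff …)` (the
adjoint, as in `B5Prop11Lattice.divT` = `∇*`; it is MINUS the backward difference: `star_fdiff_mulVec_apply`); «arbitrary derivatives»
↦ a kind `s₁ μ ∈ {true = ∂_μ, false = ∂*_μ}` for each component of the outer derivative and `s₂ ν` for each component of the inner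
one — the printed examples `∂_μG∂_ν`, `∂*_μG∂_ν`, `∂*_μG∂*_ν` are the entries `(μ, ν)` of `fieldG s₁ s₂ J` at a source with one
non-zero component `J_ν` (`gdiv s₂ J = D_νJ_ν` then), and (1.112)/(1.113) themselves are `s₁ ≡ true`, `s₂ ≡ false`
(`e4G_true_false`, `h2G_true_false`); `x ∈ Δ̃(y)`, `supp J ⊂ Δ̃(y′)`, `ζ ∈ C₀^∞(Δ̃(y))`, `|J|`, `‖J‖_ε`, `‖ζ‖_α + |ζ|`, `|y − y′|` ↦ r02 g5's
`cubeB`/`suppInL`/`cutInL`/`supNormL`/`holderL`/`cutHL`/`distSite` of `B5Prop12FieldsLattice` (the fields of `famG`'s members).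

HONEST SCOPE / DIVERGENCE.  (i) The remark is proved for the G-family of record ONLY through Proposition 1.2 for that family
(`prop12_famG_printed`, whose own method is the Combes–Thomas/L² route of p37, not the printed walk — immaterial here); the
one-torus results hold for ANY operator obeying (1.112)/(1.113) on these carriers (`e4G_le`, `h2G_le` take the printed entries as
hypotheses).
(ii) The derivation (translation + re-localisation) is ours; the print's implicit argument («the proofs … are exactly the same»)
would re-run pp. 36–40 for other derivatives.  (iii) Constants ours (`7^d`, `49^d`, `e^{6δ₀}`, `max(1, L_w) + 1`, `1 + L_w`, and
`max(C, 0)` of the family's (1.112)/(1.113) constants); `δ₀` is the family's.  (iv) Tori with at least two unit cubes per direction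
(`2 ≤ M μ`, needed for `Σ_w wP w = 1`); the family of record has `M = 2L^m`.  (v) Complex-valued carriers as everywhere in the matrix
presentation; the family statement is for REAL sources (the `LocR` of `B5SettingP12Real`), as (1.112)/(1.113) are available for them.
CELL BOOK-KEEPING (lit-balaban): NEW ROW B5.Txt@36 «p.36 remark after (1.114): arbitrary derivatives in (1.112)/(1.113)» — decl of
record `remark36_famG`; value = a located printed claim of B5 kernel-checked for the tori of record — NOT summit progress.
-/

open scoped BigOperators Matrix Real
open Finset Matrix

namespace Literature.MathematicalPhysics.QuantumFieldTheory.Balaban1983to89.B5Remark36Derivatives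

open Literature.MathematicalPhysics.QuantumFieldTheory.Balaban1983to89
open Literature.MathematicalPhysics.QuantumFieldTheory.Balaban1983to89.B5Prop11Plancherel (Tor fine unitVec shiftM fdiff)
open Literature.MathematicalPhysics.QuantumFieldTheory.Balaban1983to89.B5Prop11Lattice (grad divT)
open Literature.MathematicalPhysics.QuantumFieldTheory.Balaban1983to89.B5Prop12FieldsLattice
open Literature.MathematicalPhysics.QuantumFieldTheory.Balaban1983to89.B5DeltaA169 (DeltaA)
open Literature.MathematicalPhysics.QuantumFieldTheory.Balaban1983to89.LatticeNorms (supNorm supNorm_le norm_le_supNorm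
  supNorm_nonneg holderSeminorm holderSeminormB5 holderSeminorm_le holder_bound holderSeminorm_nonneg)
open Literature.MathematicalPhysics.QuantumFieldTheory.Balaban1983to89.B5CombesThomasLattice (nb fdiff_apply distU_triangle
  distU_step_le)
open Literature.MathematicalPhysics.QuantumFieldTheory.Balaban1983to89.B5Local114GLatticeSecond (pb nb_pb pb_nb fdiffH_apply
  cdistF_add_unitVec_le distU_le_pb distU_le_nb distU_nb_le)
open Literature.MathematicalPhysics.QuantumFieldTheory.Balaban1983to89.B5GlobCoverP12Lattice (supNorm_sum_le holderSeminorm_sum_le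
  grad_sum divT_sum smulT_sum sum_pieces_ten pieceL piece_supp piece_sup piece_holder)

noncomputable section

variable {d : ℕ}

/-! ## §1 Derivatives of either kind and the generalised second-order entries of (1.112)/(1.113) -/

section Defs

variable (n : ℕ) [NeZero n] (M : Fin d → ℕ) [∀ μ, NeZero (M μ)]

/-- **a lattice derivative of either kind in direction `ν`**: `dK true ν = ∂_ν` (the forward difference `fdiff`, (1.31)) and
`dK false ν = ∂_ν^*` (its adjoint, the `∇*` of (1.89)/(1.112); = minus the backward difference).
[cite: Balaban1984PropagatorsI, p.36 (remark after (1.114): «arbitrary derivatives, like ∂_μG∂_ν, ∂*_μG∂_ν, ∂*_μG∂*_ν»)] -/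
def dK (s : Bool) (ν : Fin d) : Matrix (Tor (fine n M) × Fin d) (Tor (fine n M) × Fin d) ℂ :=
  match s with
  | true => fdiff (fine n M) (n : ℂ) ν
  | false => star (fdiff (fine n M) (n : ℂ) ν)

/-- **the generalised divergence `Σ_ν D_ν J_ν`** of a tensor source, `D_ν = ∂_ν` or `∂_ν^*` per component (`s₂ ν`); the printed
`∇*J` of (1.112) is `s₂ ≡ false`. [cite: Balaban1984PropagatorsI, p.36 (remark after (1.114)), (1.112) p.36] -/
def gdiv (s₂ : Fin d → Bool) (J : Fin d → (Tor (fine n M) × Fin d → ℂ)) : Tor (fine n M) × Fin d → ℂ :=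
  ∑ ν, dK n M (s₂ ν) ν *ᵥ J ν

/-- **the generalised gradient `(D_μ A)_μ`** of a vector field, `D_μ = ∂_μ` or `∂_μ^*` per component (`s₁ μ`); the printed `∇A`
is `s₁ ≡ true`. [cite: Balaban1984PropagatorsI, p.36 (remark after (1.114)), (1.112) p.36] -/
def ggrad (s₁ : Fin d → Bool) (A : Tor (fine n M) × Fin d → ℂ) : Fin d → (Tor (fine n M) × Fin d → ℂ) :=
  fun μ => dK n M (s₁ μ) μ *ᵥ A

variable (a : ℝ)

/-- **the tensor field `D₁ G D₂ J`** for `G = Δ_a⁻¹ = (DeltaA n M a)⁻¹` and derivative kinds `s₁`, `s₂`.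
[cite: Balaban1984PropagatorsI, p.36 (remark after (1.114)), (1.71) p.30] -/
def fieldG (s₁ s₂ : Fin d → Bool) (J : Fin d → (Tor (fine n M) × Fin d → ℂ)) : Fin d → (Tor (fine n M) × Fin d → ℂ) :=
  ggrad n M s₁ ((DeltaA n M a)⁻¹ *ᵥ gdiv n M s₂ J)

/-- **the (1.112)-type entry `sup_{x ∈ Δ̃(y)} |(D₁ G D₂ J)(x)|`** (over all components). [cite: Balaban1984PropagatorsI, (1.112) p.36 and the remark after (1.114) p.36] -/
def e4G (s₁ s₂ : Fin d → Bool) (J : Fin d → (Tor (fine n M) × Fin d → ℂ)) (y : Tor M) : ℝ :=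
  supNorm (Finset.univ ×ˢ cubeB n M y) (fun p : Fin d × (Tor (fine n M) × Fin d) => fieldG n M a s₁ s₂ J p.1 p.2)

/-- **the (1.113)-type entry `‖ζ D₁ G D₂ J‖_α`**. [cite: Balaban1984PropagatorsI, (1.113) p.36 and the remark after (1.114) p.36] -/
def h2G (s₁ s₂ : Fin d → Bool) (J : Fin d → (Tor (fine n M) × Fin d → ℂ)) (α : ℝ) (ζ : Tor (fine n M) → ℝ) : ℝ :=
  holderT n M α (smulT n M ζ (fieldG n M a s₁ s₂ J))

variable {n M a}

/-- sanity: with `D₁ = ∇` (all forward) and `D₂ = ∇*` (all adjoint) the entry `e4G` IS the printed (1.112) entry `e4L` of the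
setting of record. [cite: Balaban1984PropagatorsI, (1.112) p.36] -/
theorem e4G_true_false (J : Fin d → (Tor (fine n M) × Fin d → ℂ)) (y : Tor M) :
    e4G n M a (fun _ => true) (fun _ => false) J y = e4L n M a (.ten J) y := rfl

/-- sanity: likewise `h2G` with `∇`, `∇*` IS the printed (1.113) entry `h2L`. [cite: Balaban1984PropagatorsI, (1.113) p.36] -/
theorem h2G_true_false (J : Fin d → (Tor (fine n M) × Fin d → ℂ)) (α : ℝ) (ζ : Tor (fine n M) → ℝ) :
    h2G n M a (fun _ => true) (fun _ => false) J α ζ = h2L n M a (.ten J) α ζ := rfl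

end Defs

/-! ## §2 The inner conversion `∂_ν v = ∂_ν^*(−S_ν v)`: `Σ_ν D_ν J_ν = ∇*J♯` with a translated source `J♯` -/

section Inner

variable (n : ℕ) [NeZero n] (M : Fin d → ℕ) [∀ μ, NeZero (M μ)]

/-- **the translated source `J♯`**: a component of forward kind is replaced by `−S_ν J_ν`, `(S_ν v)(x) = v(x + e_ν)`; components of
adjoint kind are kept. [cite: Balaban1984PropagatorsI, p.36 (remark after (1.114)), (1.31) p.23] -/
def sharp (s₂ : Fin d → Bool) (J : Fin d → (Tor (fine n M) × Fin d → ℂ)) : Fin d → (Tor (fine n M) × Fin d → ℂ) :=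
  fun ν b => if s₂ ν then -(J ν (nb n M ν b)) else J ν b

variable {n M}

/-- **`∂_ν v = ∂_ν^*(−S_ν v)`** pointwise: `n(v(x+e_ν) − v(x)) = n((−S_νv)(x − e_ν) − (−S_νv)(x))`.
[cite: Balaban1984PropagatorsI, (1.31) p.23, (1.21) p.21 (∂* the adjoint of ∂)] -/
theorem fdiff_mulVec_eq_star_mulVec_neg_shift (ν : Fin d) (v : Tor (fine n M) × Fin d → ℂ) :
    fdiff (fine n M) (n : ℂ) ν *ᵥ v = star (fdiff (fine n M) (n : ℂ) ν) *ᵥ (fun b => -(v (nb n M ν b))) := by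
  funext i
  rw [fdiff_apply, Matrix.star_eq_conjTranspose, fdiffH_apply, nb_pb, map_natCast]
  ring

/-- **`Σ_ν D_ν J_ν = ∇*J♯`**: the generalised divergence is the printed divergence of the translated source.
[cite: Balaban1984PropagatorsI, p.36 (remark after (1.114)), (1.112) p.36] -/
theorem gdiv_eq_divT_sharp (s₂ : Fin d → Bool) (J : Fin d → (Tor (fine n M) × Fin d → ℂ)) :
    gdiv n M s₂ J = divT n M (sharp n M s₂ J) := by
  unfold gdiv divT
  refine Finset.sum_congr rfl fun ν _ => ?_
  cases h : s₂ ν with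
  | false =>
      have hs : sharp n M s₂ J ν = J ν := by funext b; simp [sharp, h]
      rw [hs]; rfl
  | true =>
      have hs : sharp n M s₂ J ν = fun b => -(J ν (nb n M ν b)) := by funext b; simp [sharp, h]
      rw [hs]
      exact fdiff_mulVec_eq_star_mulVec_neg_shift ν (J ν)

end Inner

/-! ## §3 The translated source: support, sup norm, Hölder norm; cube geometry under one fine step -/

section Sharp

variable {n : ℕ} [NeZero n] {M : Fin d → ℕ} [hM : ∀ μ, NeZero (M μ)]

omit [NeZero n] hM in
/-- translation invariance of the coordinate distances: `|(x + t) − (x′ + t)|_μ = |x − x′|_μ`. [cite: Balaban1984PropagatorsI, (1.109) p.35 (|x − x′|)] -/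
theorem cdistF_add_right (x x' t : Tor (fine n M)) : cdistF n M (x + t) (x' + t) = cdistF n M x x' := by
  funext μ
  simp [cdistF, add_sub_add_right_eq_sub]

omit [NeZero n] hM in
/-- translation invariance of `|x − x′|`: `|(x + t) − (x′ + t)| = |x − x′|`. [cite: Balaban1984PropagatorsI, (1.109) p.35 (|x − x′|)] -/
theorem distU_add_right (x x' t : Tor (fine n M)) : distU n M (x + t) (x' + t) = distU n M x x' := by
  unfold distU
  rw [cdistF_add_right]

/-- **`supp J ⊂ Δ̃(y′)` ⇒ every bond of `supp J♯` lies in `Δ̃(y′)` or one fine step before it.**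
[cite: Balaban1984PropagatorsI, Prop. 1.2 (1.112) p.36 (supp J ⊂ Δ̃(y′)), (1.31) p.23] -/
theorem sharp_supp {J : Fin d → (Tor (fine n M) × Fin d → ℂ)} {y' : Tor M} (hJ : suppInL n M (.ten J) y')
    (s₂ : Fin d → Bool) (ν : Fin d) (b : Tor (fine n M) × Fin d) (hb : sharp n M s₂ J ν b ≠ 0) :
    b.1 ∈ cubeT n M y' ∨ b.1 + unitVec (fine n M) ν ∈ cubeT n M y' := by
  cases h : s₂ ν with
  | false =>
      have hb' : J ν b ≠ 0 := by simpa [sharp, h] using hb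
      exact Or.inl (hJ ν b hb')
  | true =>
      have hb' : J ν (b.1 + unitVec (fine n M) ν, b.2) ≠ 0 := by simpa [sharp, h, nb] using hb
      exact Or.inr (hJ ν (b.1 + unitVec (fine n M) ν, b.2) hb')

/-- **`|J♯| ≤ |J|`** (values of `J♯` are values of `J` up to sign). [cite: Balaban1984PropagatorsI, (1.108) p.35, p.36 (remark after (1.114))] -/
theorem supNorm_sharp_le (s₂ : Fin d → Bool) (J : Fin d → (Tor (fine n M) × Fin d → ℂ)) :
    supNormL n M (.ten (sharp n M s₂ J)) ≤ supNormL n M (.ten J) := by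
  refine supNorm_le (supNorm_nonneg _ _) fun p _ => ?_
  cases h : s₂ p.1 with
  | false =>
      have : sharp n M s₂ J p.1 p.2 = J p.1 p.2 := by simp [sharp, h]
      rw [this]
      exact norm_le_supNorm (fun q : Fin d × (Tor (fine n M) × Fin d) => J q.1 q.2) (Finset.mem_univ (p.1, p.2))
  | true =>
      have : sharp n M s₂ J p.1 p.2 = -(J p.1 (nb n M p.1 p.2)) := by simp [sharp, h]
      rw [this, norm_neg]
      exact norm_le_supNorm (fun q : Fin d × (Tor (fine n M) × Fin d) => J q.1 q.2) (Finset.mem_univ (p.1, nb n M p.1 p.2))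

/-- **`‖J♯‖_ε ≤ ‖J‖_ε`** (the Hölder seminorm (1.109) is translation invariant). [cite: Balaban1984PropagatorsI, (1.109) p.35, p.36 (remark after (1.114))] -/
theorem holder_sharp_le (s₂ : Fin d → Bool) (J : Fin d → (Tor (fine n M) × Fin d → ℂ)) (ε : ℝ) :
    holderL n M ε (.ten (sharp n M s₂ J)) ≤ holderL n M ε (.ten J) := by
  show holderT n M ε (sharp n M s₂ J) ≤ holderT n M ε J
  unfold holderT holderSeminormB5
  refine holderSeminorm_le (holderSeminorm_nonneg _ _ _ _ _ _) fun p _ p' _ hadm hpos => ?_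
  obtain ⟨⟨h1, h2⟩, hle⟩ := hadm
  rw [id]
  cases h : s₂ p.1 with
  | false =>
      have e1 : sharp n M s₂ J p.1 p.2 = J p.1 p.2 := by simp [sharp, h]
      have e2 : sharp n M s₂ J p'.1 p'.2 = J p'.1 p'.2 := by simp [sharp, ← h1, h]
      rw [e1, e2]
      exact holder_bound (τ := fun _ _ => id) (fun q : Fin d × (Tor (fine n M) × Fin d) => J q.1 q.2)
        (Finset.mem_univ p) (Finset.mem_univ p') ⟨⟨h1, h2⟩, hle⟩ hpos
  | true =>
      have e1 : sharp n M s₂ J p.1 p.2 = -(J p.1 (nb n M p.1 p.2)) := by simp [sharp, h]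
      have e2 : sharp n M s₂ J p'.1 p'.2 = -(J p'.1 (nb n M p'.1 p'.2)) := by simp [sharp, ← h1, h]
      rw [e1, e2, neg_sub_neg, norm_sub_rev]
      have hd : distU n M (nb n M p.1 p.2).1 (nb n M p'.1 p'.2).1 = distU n M p.2.1 p'.2.1 := by
        rw [← h1]; exact distU_add_right _ _ _
      have hb := holder_bound (α := ε) (adm := fun q q' : Fin d × (Tor (fine n M) × Fin d) =>
          (q.1 = q'.1 ∧ q.2.2 = q'.2.2) ∧ distU n M q.2.1 q'.2.1 ≤ 1)
        (dist := fun q q' => distU n M q.2.1 q'.2.1) (τ := fun _ _ => id) (S := Finset.univ)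
        (fun q : Fin d × (Tor (fine n M) × Fin d) => J q.1 q.2) (x := (p.1, nb n M p.1 p.2)) (x' := (p'.1, nb n M p'.1 p'.2))
        (Finset.mem_univ _) (Finset.mem_univ _) ⟨⟨h1, by simp [nb, h2]⟩, by rw [hd]; exact hle⟩ (by rw [hd]; exact hpos)
      rw [id, hd] at hb
      exact hb

/-- `x ∈ Δ̃(y)` iff `|x − n·y| ≤ 1` in units. [cite: Balaban1984PropagatorsI, p.35 (the cubes Δ̃(y))] -/
theorem mem_cubeT_iff_distU (x : Tor (fine n M)) (y : Tor M) : x ∈ cubeT n M y ↔ distU n M x (toFine n M y) ≤ 1 := by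
  have hn : (0 : ℝ) < n := by exact_mod_cast Nat.pos_of_ne_zero (NeZero.ne n)
  rw [B5SiteBridgeP12.mem_cubeT_iff, distU, div_le_one hn, Nat.cast_le, Finset.sup_le_iff]
  simp

/-- **labels of overlapping doubled cubes are close**: `x ∈ Δ̃(y)`, `x′ ∈ Δ̃(w)` ⇒ `|y − w| ≤ |x − x′| + 2`.
[cite: Balaban1984PropagatorsI, p.35 (the cubes Δ̃(y)), Prop. 1.2 (1.110) p.35 (|y − y′|)] -/
theorem distSite_le_distU_add_two (hn : 1 ≤ n) {x x' : Tor (fine n M)} {y w : Tor M} (hx : x ∈ cubeT n M y)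
    (hx' : x' ∈ cubeT n M w) : distSite M y w ≤ distU n M x x' + 2 := by
  refine B5Carrier132CubeGeom.distSite_le_of_forall_crep M y w (by linarith [distU_nonneg (n := n) (M := M) x x']) fun μ => ?_
  have hM0 : (0 : ℝ) < M μ := by exact_mod_cast B6Cov2156Torus.one_le_M M μ
  have h1 : |B5Partition118Printed.crep (M μ) (((y μ).val : ℝ) - B5CoverP12Lattice.uc M n x μ)| ≤ 1 := by
    rw [show ((y μ).val : ℝ) - B5CoverP12Lattice.uc M n x μ = -(B5CoverP12Lattice.uc M n x μ - ((y μ).val : ℝ)) by ring,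
      B5CoverP12Lattice.abs_crep_neg hM0]
    exact (B5CoverP12Lattice.mem_cubeT_iff_crep M n hn x y).mp hx μ
  have h2 : |B5Partition118Printed.crep (M μ) (B5CoverP12Lattice.uc M n x μ - B5CoverP12Lattice.uc M n x' μ)| ≤ distU n M x x' :=
    B5CoverP12Lattice.abs_crep_uc_sub_le_distU M n hn x x' μ
  have h3 : |B5Partition118Printed.crep (M μ) (B5CoverP12Lattice.uc M n x' μ - ((w μ).val : ℝ))| ≤ 1 :=
    (B5CoverP12Lattice.mem_cubeT_iff_crep M n hn x' w).mp hx' μ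
  have e : ((y μ).val : ℝ) - ((w μ).val : ℝ)
      = ((((y μ).val : ℝ) - B5CoverP12Lattice.uc M n x μ) + (B5CoverP12Lattice.uc M n x μ - B5CoverP12Lattice.uc M n x' μ))
        + (B5CoverP12Lattice.uc M n x' μ - ((w μ).val : ℝ)) := by ring
  rw [e]
  refine (B5CoverP12Lattice.abs_crep_add_le hM0 _ _).trans ?_
  have h12 := B5CoverP12Lattice.abs_crep_add_le hM0 (((y μ).val : ℝ) - B5CoverP12Lattice.uc M n x μ)
    (B5CoverP12Lattice.uc M n x μ - B5CoverP12Lattice.uc M n x' μ)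
  linarith

/-- one fine step costs at most one unit: `|x − (x + e_ν)| ≤ 1`. [cite: Balaban1984PropagatorsI, p.35 (T_η), (1.109) p.35] -/
theorem distU_step_le_one (x : Tor (fine n M)) (ν : Fin d) : distU n M x (x + unitVec (fine n M) ν) ≤ 1 := by
  have hn : (1 : ℝ) ≤ n := by exact_mod_cast Nat.one_le_iff_ne_zero.mpr (NeZero.ne n)
  exact (distU_step_le n M x ν).trans (by rw [div_le_one (by linarith)]; exact hn)

/-- **labels: `x ∈ Δ̃(y)` and `x + e_ν ∈ Δ̃(w)` (or `x − e_ν ∈ Δ̃(w)`) force `|y − w| ≤ 3`.**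
[cite: Balaban1984PropagatorsI, p.35 (the cubes Δ̃(y)), (1.110) p.35 (|y − y′|)] -/
theorem distSite_le_three_of_nb (hn : 1 ≤ n) {x : Tor (fine n M)} {y w : Tor M} (ν : Fin d) (hx : x ∈ cubeT n M y)
    (hx' : x + unitVec (fine n M) ν ∈ cubeT n M w) : distSite M y w ≤ 3 := by
  have h := distSite_le_distU_add_two hn hx hx'
  linarith [distU_step_le_one x ν]

/-- the same with a backward step. [cite: Balaban1984PropagatorsI, p.35 (the cubes Δ̃(y)), (1.110) p.35 (|y − y′|)] -/
theorem distSite_le_three_of_pb (hn : 1 ≤ n) {x : Tor (fine n M)} {y w : Tor M} (ν : Fin d) (hx : x ∈ cubeT n M y)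
    (hx' : x - unitVec (fine n M) ν ∈ cubeT n M w) : distSite M y w ≤ 3 := by
  have h := distSite_le_distU_add_two hn hx hx'
  have h1 : distU n M x (x - unitVec (fine n M) ν) ≤ 1 := by
    have := distU_step_le_one (x - unitVec (fine n M) ν) ν
    rw [sub_add_cancel] at this
    rwa [B5CoverP12Lattice.distU_comm]
  linarith

/-- the same with zero steps: `x ∈ Δ̃(y) ∩ Δ̃(w)` ⇒ `|y − w| ≤ 3` (indeed `≤ 2`). [cite: Balaban1984PropagatorsI, p.35 (the cubes Δ̃(y))] -/
theorem distSite_le_three_of_mem (hn : 1 ≤ n) {x : Tor (fine n M)} {y w : Tor M} (hx : x ∈ cubeT n M y)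
    (hx' : x ∈ cubeT n M w) : distSite M y w ≤ 3 := by
  have h := distSite_le_distU_add_two hn hx hx'
  rw [distU_self] at h
  linarith

/-- **at most `7^d` unit-lattice labels within distance `3`.** [cite: Balaban1984PropagatorsI, p.35 (T₁^{(k)}), p.39 («an absolute constant depending on d only»)] -/
theorem card_near_le (y : Tor M) : ((Finset.univ.filter fun w : Tor M => distSite M y w ≤ 3).card : ℝ) ≤ (7 : ℝ) ^ d := by
  have h := B5RowSumsP12Lattice.ballCard_distSite_le M y (show (0 : ℝ) ≤ 3 by norm_num)
  have h3 : (⌊(3 : ℝ)⌋₊ : ℝ) = 3 := by norm_num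
  rw [h3] at h
  norm_num at h
  exact h

end Sharp

/-! ## §4 The outer conversion for the sup entry: `(∂_μ^* A)(x) = −(∂_μ A)(x − e_μ)`, `x − e_μ ∈ Δ̃(y″)`, `|y″ − y| ≤ 3` -/

section OuterSup

variable {n : ℕ} [NeZero n] {M : Fin d → ℕ} [hM : ∀ μ, NeZero (M μ)] {a : ℝ}

/-- **`(∂_μ^* A)(b) = −(∂_μ A)(b − e_μ)`** pointwise. [cite: Balaban1984PropagatorsI, (1.31) p.23, (1.21) p.21 (∂* the adjoint of ∂)] -/
theorem star_fdiff_mulVec_apply (μ : Fin d) (A : Tor (fine n M) × Fin d → ℂ) (b : Tor (fine n M) × Fin d) :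
    (star (fdiff (fine n M) (n : ℂ) μ) *ᵥ A) b = -((fdiff (fine n M) (n : ℂ) μ *ᵥ A) (pb n M μ b)) := by
  rw [Matrix.star_eq_conjTranspose, fdiffH_apply, fdiff_apply, nb_pb, map_natCast]
  ring

/-- a component of forward kind of the generalised gradient is the printed gradient component. [cite: Balaban1984PropagatorsI, p.36 (remark after (1.114))] -/
theorem ggrad_apply_of_true {s₁ : Fin d → Bool} (A : Tor (fine n M) × Fin d → ℂ) {μ : Fin d} (h : s₁ μ = true)
    (b : Tor (fine n M) × Fin d) : ggrad n M s₁ A μ b = grad n M A μ b := by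
  simp [ggrad, h, dK, grad]

/-- a component of adjoint kind of the generalised gradient is minus the printed gradient component one step back.
[cite: Balaban1984PropagatorsI, p.36 (remark after (1.114)), (1.31) p.23] -/
theorem ggrad_apply_of_false {s₁ : Fin d → Bool} (A : Tor (fine n M) × Fin d → ℂ) {μ : Fin d} (h : s₁ μ = false)
    (b : Tor (fine n M) × Fin d) : ggrad n M s₁ A μ b = -(grad n M A μ (b.1 - unitVec (fine n M) μ, b.2)) := by
  simp only [ggrad, h, dK, grad]
  rw [star_fdiff_mulVec_apply]
  rfl

/-- **THE OUTER CONVERSION, SUP ENTRY**: if the printed (1.112) entries of a source `K` decay from the label `w` at every label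
`y₁` (`sup_{Δ̃(y₁)}|∇G∇*K| ≤ C e^{−δ₀|y₁−w|} N`), then so do the generalised entries `sup_{Δ̃(y)}|D₁G∇*K|`, with the constant
`C e^{3δ₀}`: a value `(∂_μ^*G∇*K)(x)`, `x ∈ Δ̃(y)`, is `−(∂_μG∇*K)(x − e_μ)` and `x − e_μ ∈ Δ̃(y₁)` with `|y₁ − y| ≤ 3`.
[cite: Balaban1984PropagatorsI, p.36 (remark after (1.114)), (1.112) p.36] -/
theorem sup_ggrad_le (hn : 1 ≤ n) (s₁ : Fin d → Bool) (K : Fin d → (Tor (fine n M) × Fin d → ℂ)) {C δ₀ N : ℝ}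
    (hC : 0 ≤ C) (hδ : 0 ≤ δ₀) (hN : 0 ≤ N) (w y : Tor M)
    (h : ∀ y₁ : Tor M, e4L n M a (.ten K) y₁ ≤ C * Real.exp (-(δ₀ * distSite M y₁ w)) * N) :
    supNorm (Finset.univ ×ˢ cubeB n M y)
        (fun p : Fin d × (Tor (fine n M) × Fin d) => ggrad n M s₁ ((DeltaA n M a)⁻¹ *ᵥ divT n M K) p.1 p.2)
      ≤ C * Real.exp (3 * δ₀) * Real.exp (-(δ₀ * distSite M y w)) * N := by
  have h' : ∀ y₁ : Tor M, supNorm (Finset.univ ×ˢ cubeB n M y₁)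
      (fun q : Fin d × (Tor (fine n M) × Fin d) => grad n M ((DeltaA n M a)⁻¹ *ᵥ divT n M K) q.1 q.2)
        ≤ C * Real.exp (-(δ₀ * distSite M y₁ w)) * N := fun y₁ => by
    simpa only [e4L] using h y₁
  set A := (DeltaA n M a)⁻¹ *ᵥ divT n M K with hA
  refine supNorm_le (by positivity) fun p hp => ?_
  have hb : p.2 ∈ cubeB n M y := (Finset.mem_product.mp hp).2
  have hx : p.2.1 ∈ cubeT n M y := (Finset.mem_product.mp hb).1
  have key : ∃ y₁ : Tor M, distSite M y y₁ ≤ 3 ∧ ‖ggrad n M s₁ A p.1 p.2‖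
      ≤ supNorm (Finset.univ ×ˢ cubeB n M y₁) (fun q : Fin d × (Tor (fine n M) × Fin d) => grad n M A q.1 q.2) := by
    cases h1 : s₁ p.1 with
    | true =>
        refine ⟨y, ?_, ?_⟩
        · rw [distSite_self]; norm_num
        · rw [ggrad_apply_of_true A h1]
          exact norm_le_supNorm (fun q : Fin d × (Tor (fine n M) × Fin d) => grad n M A q.1 q.2) (x := p) hp
    | false =>
        have hmem : (p.2.1 - unitVec (fine n M) p.1, p.2.2) ∈ cubeB n M (B5CoverP12Lattice.nearOf M n (p.2.1 - unitVec (fine n M) p.1)) :=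
          B5CoverP12Lattice.mem_cubeB_nearOf M n hn (p.2.1 - unitVec (fine n M) p.1, p.2.2)
        have hx' : p.2.1 - unitVec (fine n M) p.1 ∈ cubeT n M (B5CoverP12Lattice.nearOf M n (p.2.1 - unitVec (fine n M) p.1)) :=
          (Finset.mem_product.mp hmem).1
        refine ⟨B5CoverP12Lattice.nearOf M n (p.2.1 - unitVec (fine n M) p.1), distSite_le_three_of_pb hn p.1 hx hx', ?_⟩
        rw [ggrad_apply_of_false A h1, norm_neg]
        exact norm_le_supNorm (fun q : Fin d × (Tor (fine n M) × Fin d) => grad n M A q.1 q.2)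
          (x := (p.1, (p.2.1 - unitVec (fine n M) p.1, p.2.2))) (Finset.mem_product.mpr ⟨Finset.mem_univ _, hmem⟩)
  obtain ⟨y₁, hy₁, hle⟩ := key
  have htri : distSite M y w ≤ 3 + distSite M y₁ w :=
    (B5RowSumsP12Lattice.distSite_triangle M y y₁ w).trans (by linarith)
  have hexp : Real.exp (-(δ₀ * distSite M y₁ w)) ≤ Real.exp (3 * δ₀) * Real.exp (-(δ₀ * distSite M y w)) := by
    rw [← Real.exp_add]
    exact Real.exp_le_exp.mpr (by nlinarith)
  calc ‖ggrad n M s₁ A p.1 p.2‖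
      ≤ supNorm (Finset.univ ×ˢ cubeB n M y₁) (fun q : Fin d × (Tor (fine n M) × Fin d) => grad n M A q.1 q.2) := hle
    _ ≤ C * Real.exp (-(δ₀ * distSite M y₁ w)) * N := h' y₁
    _ ≤ C * (Real.exp (3 * δ₀) * Real.exp (-(δ₀ * distSite M y w))) * N := by gcongr
    _ = C * Real.exp (3 * δ₀) * Real.exp (-(δ₀ * distSite M y w)) * N := by ring

end OuterSup

/-! ## §5 The outer conversion for the Hölder entry: `ζ·(∂_μ^*A) = −S_μ^{-1}[(S_μζ)·∂_μA]`, the translated cut-off re-localised -/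

section OuterHolder

variable {n : ℕ} [NeZero n] {M : Fin d → ℕ} [hM : ∀ μ, NeZero (M μ)] {a : ℝ}

/-- the translated cut-off `(S_μζ)(z) = ζ(z + e_μ)`. [cite: Balaban1984PropagatorsI, Prop. 1.2 (1.113) p.36 (ζ ∈ C₀^∞(Δ̃(y)))] -/
def shiftCut (μ : Fin d) (ζ : Tor (fine n M) → ℝ) : Tor (fine n M) → ℝ := fun z => ζ (z + unitVec (fine n M) μ)

/-- `|S_μζ| ≤ |ζ|` (indeed `=`). [cite: Balaban1984PropagatorsI, Prop. 1.2 (1.111) p.35 (|ζ|)] -/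
theorem cutSupL_shiftCut_le (μ : Fin d) (ζ : Tor (fine n M) → ℝ) : cutSupL n M (shiftCut μ ζ) ≤ cutSupL n M ζ :=
  supNorm_le (supNorm_nonneg _ _) fun z _ => norm_le_supNorm ζ (Finset.mem_univ (z + unitVec (fine n M) μ))

/-- `‖S_μζ‖_α + |S_μζ| ≤ ‖ζ‖_α + |ζ|` (translation invariance of (1.109)). [cite: Balaban1984PropagatorsI, Prop. 1.2 (1.111) p.35 (‖ζ‖_α + |ζ|), (1.109) p.35] -/
theorem cutHL_shiftCut_le (μ : Fin d) (α : ℝ) (ζ : Tor (fine n M) → ℝ) : cutHL n M α (shiftCut μ ζ) ≤ cutHL n M α ζ := by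
  unfold cutHL
  refine add_le_add ?_ (cutSupL_shiftCut_le μ ζ)
  unfold holderSeminormB5
  refine holderSeminorm_le (holderSeminorm_nonneg _ _ _ _ _ _) fun x _ x' _ hadm hpos => ?_
  obtain ⟨-, hle⟩ := hadm
  have hd : distU n M (x + unitVec (fine n M) μ) (x' + unitVec (fine n M) μ) = distU n M x x' := distU_add_right _ _ _
  have hb := holder_bound (α := α) (adm := fun q q' : Tor (fine n M) => True ∧ distU n M q q' ≤ 1) (dist := distU n M)
    (τ := fun _ _ => id) (S := Finset.univ) ζ (x := x + unitVec (fine n M) μ) (x' := x' + unitVec (fine n M) μ)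
    (Finset.mem_univ _) (Finset.mem_univ _) ⟨trivial, by rw [hd]; exact hle⟩ (by rw [hd]; exact hpos)
  rw [hd] at hb
  exact hb

/-- the re-localised translated cut-offs `ζ′_{y₁}·S_μζ` (`ζ′_{y₁} = wP y₁`, r02 g5's unit-scale partition of (1.118)).
[cite: Balaban1984PropagatorsI, (1.118) p.36, Prop. 1.2 (1.113) p.36] -/
def locCut (y₁ : Tor M) (ξ : Tor (fine n M) → ℝ) : Tor (fine n M) → ℝ := fun z => B5CoverP12Lattice.wP M n y₁ z * ξ z

/-- `supp (ζ′_{y₁}ξ) ⊂ Δ̃(y₁)` whatever `ξ`. [cite: Balaban1984PropagatorsI, Prop. 1.2 (1.113) p.36 (ζ ∈ C₀^∞(Δ̃(y)))] -/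
theorem cutInL_locCut (hn : 1 ≤ n) (y₁ : Tor M) (ξ : Tor (fine n M) → ℝ) : cutInL n M (locCut y₁ ξ) y₁ := by
  intro z hz
  by_contra hmem
  exact hz (by rw [locCut, B5CoverP12Lattice.wP_eq_zero_of_not_mem M n hn hmem, zero_mul])

/-- **`‖ζ′_{y₁}ξ‖_α + |ζ′_{y₁}ξ| ≤ (1 + Lw d)(‖ξ‖_α + |ξ|)`** for `α ≤ 1` (unit-scale Lipschitz weight, tori with `≥ 2` unit cubes per
direction). [cite: Balaban1984PropagatorsI, Prop. 1.2 (1.111) p.35 (‖ζ‖_α + |ζ|), (1.118) p.36] -/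
theorem cutHL_locCut_le (hn : 1 ≤ n) (hM2 : ∀ μ, 2 ≤ M μ) (y₁ : Tor M) {α : ℝ} (hα : α ≤ 1) (ξ : Tor (fine n M) → ℝ) :
    cutHL n M α (locCut y₁ ξ) ≤ (1 + B5CoverP12Lattice.Lw d) * cutHL n M α ξ := by
  have hL := B5CoverP12Lattice.Lw_nonneg d
  have hS0 : 0 ≤ cutSupL n M ξ := cutSupL_nonneg ξ
  have hH0 : 0 ≤ holderSeminormB5 α (fun _ _ : Tor (fine n M) => True) (distU n M) Finset.univ ξ :=
    holderSeminorm_nonneg _ _ _ _ _ _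
  have hsup : cutSupL n M (locCut y₁ ξ) ≤ cutSupL n M ξ := by
    refine supNorm_le hS0 fun z _ => ?_
    rw [locCut, norm_mul, Real.norm_eq_abs, abs_of_nonneg (B5CoverP12Lattice.wP_nonneg M n y₁ z)]
    exact (mul_le_mul_of_nonneg_right (B5CoverP12Lattice.wP_le_one M n y₁ z) (norm_nonneg _)).trans
      (by rw [one_mul]; exact norm_le_supNorm ξ (Finset.mem_univ z))
  have hhol : holderSeminormB5 α (fun _ _ : Tor (fine n M) => True) (distU n M) Finset.univ (locCut y₁ ξ)
      ≤ holderSeminormB5 α (fun _ _ : Tor (fine n M) => True) (distU n M) Finset.univ ξ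
        + B5CoverP12Lattice.Lw d * cutSupL n M ξ := by
    unfold holderSeminormB5
    refine holderSeminorm_le (by positivity) fun x _ x' _ hadm hpos => ?_
    obtain ⟨-, hle1⟩ := hadm
    set t := distU n M x x' with ht
    have htα : t ≤ t ^ α := by
      have h := Real.rpow_le_rpow_of_exponent_ge hpos hle1 hα
      rwa [Real.rpow_one] at h
    have htα0 : 0 ≤ t ^ α := Real.rpow_nonneg hpos.le α
    have h1 : ‖ξ x' - ξ x‖ ≤ holderSeminormB5 α (fun _ _ : Tor (fine n M) => True) (distU n M) Finset.univ ξ * t ^ α :=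
      holder_bound (α := α) (adm := fun q q' : Tor (fine n M) => True ∧ distU n M q q' ≤ 1) (dist := distU n M)
        (τ := fun _ _ => id) (S := Finset.univ) ξ (Finset.mem_univ x) (Finset.mem_univ x') ⟨trivial, hle1⟩ hpos
    have h2 : ‖ξ x‖ ≤ cutSupL n M ξ := norm_le_supNorm ξ (Finset.mem_univ x)
    have h3 : ‖B5CoverP12Lattice.wP M n y₁ x' - B5CoverP12Lattice.wP M n y₁ x‖ ≤ B5CoverP12Lattice.Lw d * t := by
      rw [Real.norm_eq_abs, abs_sub_comm]; exact B5CoverP12Lattice.abs_wP_sub_le M n hn hM2 y₁ x x'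
    have hw1 : ‖B5CoverP12Lattice.wP M n y₁ x'‖ ≤ 1 := by
      rw [Real.norm_eq_abs, abs_of_nonneg (B5CoverP12Lattice.wP_nonneg M n y₁ x')]; exact B5CoverP12Lattice.wP_le_one M n y₁ x'
    rw [id]
    show ‖locCut y₁ ξ x' - locCut y₁ ξ x‖ ≤ _
    have e : locCut y₁ ξ x' - locCut y₁ ξ x
        = B5CoverP12Lattice.wP M n y₁ x' * (ξ x' - ξ x) + (B5CoverP12Lattice.wP M n y₁ x' - B5CoverP12Lattice.wP M n y₁ x) * ξ x := by
      simp only [locCut]; ring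
    rw [e]
    calc ‖B5CoverP12Lattice.wP M n y₁ x' * (ξ x' - ξ x) + (B5CoverP12Lattice.wP M n y₁ x' - B5CoverP12Lattice.wP M n y₁ x) * ξ x‖
        ≤ ‖B5CoverP12Lattice.wP M n y₁ x' * (ξ x' - ξ x)‖ + ‖(B5CoverP12Lattice.wP M n y₁ x' - B5CoverP12Lattice.wP M n y₁ x) * ξ x‖ :=
          norm_add_le _ _
      _ = ‖B5CoverP12Lattice.wP M n y₁ x'‖ * ‖ξ x' - ξ x‖ + ‖B5CoverP12Lattice.wP M n y₁ x' - B5CoverP12Lattice.wP M n y₁ x‖ * ‖ξ x‖ := by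
          rw [norm_mul, norm_mul]
      _ ≤ 1 * (holderSeminormB5 α (fun _ _ : Tor (fine n M) => True) (distU n M) Finset.univ ξ * t ^ α)
          + B5CoverP12Lattice.Lw d * t * cutSupL n M ξ :=
          add_le_add (mul_le_mul hw1 h1 (norm_nonneg _) zero_le_one)
            (mul_le_mul h3 h2 (norm_nonneg _) (mul_nonneg hL hpos.le))
      _ ≤ (holderSeminormB5 α (fun _ _ : Tor (fine n M) => True) (distU n M) Finset.univ ξ
          + B5CoverP12Lattice.Lw d * cutSupL n M ξ) * t ^ α := by
          have hmono : B5CoverP12Lattice.Lw d * t * cutSupL n M ξ ≤ B5CoverP12Lattice.Lw d * cutSupL n M ξ * t ^ α := by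
            calc B5CoverP12Lattice.Lw d * t * cutSupL n M ξ = B5CoverP12Lattice.Lw d * cutSupL n M ξ * t := by ring
              _ ≤ B5CoverP12Lattice.Lw d * cutSupL n M ξ * t ^ α := mul_le_mul_of_nonneg_left htα (mul_nonneg hL hS0)
          have e : (holderSeminormB5 α (fun _ _ : Tor (fine n M) => True) (distU n M) Finset.univ ξ
              + B5CoverP12Lattice.Lw d * cutSupL n M ξ) * t ^ α
              = holderSeminormB5 α (fun _ _ : Tor (fine n M) => True) (distU n M) Finset.univ ξ * t ^ α
                + B5CoverP12Lattice.Lw d * cutSupL n M ξ * t ^ α := by ring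
          rw [e, one_mul]
          linarith
  unfold cutHL
  calc holderSeminormB5 α (fun _ _ : Tor (fine n M) => True) (distU n M) Finset.univ (locCut y₁ ξ) + cutSupL n M (locCut y₁ ξ)
      ≤ (holderSeminormB5 α (fun _ _ : Tor (fine n M) => True) (distU n M) Finset.univ ξ + B5CoverP12Lattice.Lw d * cutSupL n M ξ)
        + cutSupL n M ξ := add_le_add hhol hsup
    _ ≤ (1 + B5CoverP12Lattice.Lw d) * (holderSeminormB5 α (fun _ _ : Tor (fine n M) => True) (distU n M) Finset.univ ξ
        + cutSupL n M ξ) := by nlinarith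

omit [NeZero n] in
/-- **`S_μζ = Σ_{y₁} ζ′_{y₁}·S_μζ` inside a cut-off product** (`Σ_{y₁} wP y₁ = 1`): the tensor field `(S_μζ)·F` is the finite sum
of the fields `(ζ′_{y₁}S_μζ)·F`. [cite: Balaban1984PropagatorsI, (1.118) p.36 («Σ_z h_z² = 1»), Prop. 1.2 (1.113) p.36] -/
theorem smulT_eq_sum_locCut (hM2 : ∀ μ, 2 ≤ M μ) (ξ : Tor (fine n M) → ℝ) (F : Fin d → (Tor (fine n M) × Fin d → ℂ)) :
    smulT n M ξ F = ∑ y₁ : Tor M, smulT n M (locCut y₁ ξ) F := by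
  funext s b
  rw [Finset.sum_apply, Finset.sum_apply]
  simp only [smulT, locCut, Complex.ofReal_mul]
  rw [← Finset.sum_mul, ← Finset.sum_mul, ← Complex.ofReal_sum, B5CoverP12Lattice.sum_wP M n hM2 b.1, Complex.ofReal_one,
    one_mul]

/-- if the re-localised cut-off `ζ′_{y₁}S_μζ` is not identically zero and `supp ζ ⊂ Δ̃(y)`, then `|y₁ − y| ≤ 3`.
[cite: Balaban1984PropagatorsI, p.35 (the cubes Δ̃(y)), (1.118) p.36] -/
theorem distSite_le_three_of_locCut_ne (hn : 1 ≤ n) {ζ : Tor (fine n M) → ℝ} {y : Tor M} (hζ : cutInL n M ζ y) (μ : Fin d)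
    {y₁ : Tor M} {z : Tor (fine n M)} (hz : locCut y₁ (shiftCut μ ζ) z ≠ 0) : distSite M y₁ y ≤ 3 := by
  have h1 : B5CoverP12Lattice.wP M n y₁ z ≠ 0 := fun h => hz (by rw [locCut, h, zero_mul])
  have h2 : ζ (z + unitVec (fine n M) μ) ≠ 0 := fun h => hz (by rw [locCut, shiftCut, h, mul_zero])
  exact distSite_le_three_of_nb hn μ (B5CoverP12Lattice.mem_cubeT_of_wP_ne_zero M n hn h1) (hζ _ h2)

omit [NeZero n] hM in
/-- translation invariance of `|x − x′|` under a backward step: `|(x − t) − (x′ − t)| = |x − x′|`. [cite: Balaban1984PropagatorsI, (1.109) p.35] -/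
theorem distU_sub_right (x x' t : Tor (fine n M)) : distU n M (x - t) (x' - t) = distU n M x x' := by
  simpa only [sub_eq_add_neg] using distU_add_right x x' (-t)

/-- a cut-off that vanishes identically has `‖ξ‖_α + |ξ| ≤ 0`. [cite: Balaban1984PropagatorsI, Prop. 1.2 (1.111) p.35 (‖ζ‖_α + |ζ|)] -/
theorem cutHL_le_zero_of_forall_eq_zero {ξ : Tor (fine n M) → ℝ} (h : ∀ z, ξ z = 0) (α : ℝ) : cutHL n M α ξ ≤ 0 := by
  unfold cutHL cutSupL holderSeminormB5
  refine (add_le_add (holderSeminorm_le le_rfl fun x _ x' _ _ _ => ?_) (supNorm_le le_rfl fun z _ => ?_)).trans (by norm_num)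
  · rw [id, h x, h x', sub_zero, norm_zero, zero_mul]
  · rw [h z, norm_zero]

/-- bookkeeping: a sum of terms supported on the labels within distance `3` of `y`, each at most `X ≥ 0`, is at most `7^d·X`.
[cite: Balaban1984PropagatorsI, p.39 («an absolute constant depending on d only»)] -/
theorem sum_near_le {T : Tor M → ℝ} {X : ℝ} (hX : 0 ≤ X) (y : Tor M)
    (h : ∀ y₁, T y₁ ≤ if distSite M y y₁ ≤ 3 then X else 0) : ∑ y₁ : Tor M, T y₁ ≤ (7 : ℝ) ^ d * X := by
  calc ∑ y₁ : Tor M, T y₁ ≤ ∑ y₁ : Tor M, (if distSite M y y₁ ≤ 3 then X else 0) := Finset.sum_le_sum fun y₁ _ => h y₁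
    _ = ((Finset.univ.filter fun y₁ : Tor M => distSite M y y₁ ≤ 3).card : ℝ) * X := by
        rw [← Finset.sum_filter, Finset.sum_const, nsmul_eq_mul]
    _ ≤ (7 : ℝ) ^ d * X := mul_le_mul_of_nonneg_right (card_near_le y) hX

/-- **THE OUTER CONVERSION, HÖLDER ENTRY**: if the printed (1.113) entries of a source `K` obey
`‖ζ₁∇G∇*K‖_α ≤ C e^{−δ₀|y₁−w|}(‖ζ₁‖_α + |ζ₁|)N` for every label `y₁` and cut-off `ζ₁ ∈ C₀^∞(Δ̃(y₁))`, then for `ζ ∈ C₀^∞(Δ̃(y))`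
the generalised entry obeys `‖ζD₁G∇*K‖_α ≤ 7^d(1 + L_w)C e^{3δ₀}·e^{−δ₀|y−w|}(‖ζ‖_α + |ζ|)N`: a component `ζ·∂_μ^*G∇*K` is
`−S_μ^{-1}[(S_μζ)·∂_μG∇*K]`, the Hölder quotients are translation invariant, and `S_μζ = Σ_{|y₁−y|≤3} ζ′_{y₁}S_μζ` with
`‖ζ′_{y₁}S_μζ‖_α + |ζ′_{y₁}S_μζ| ≤ (1 + L_w)(‖ζ‖_α + |ζ|)`. [cite: Balaban1984PropagatorsI, p.36 (remark after (1.114)), (1.113) p.36] -/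
theorem holder_ggrad_le (hn : 1 ≤ n) (hM2 : ∀ μ, 2 ≤ M μ) (s₁ : Fin d → Bool) (K : Fin d → (Tor (fine n M) × Fin d → ℂ))
    {C δ₀ N α : ℝ} (hC : 0 ≤ C) (hδ : 0 ≤ δ₀) (hN : 0 ≤ N) (hα : α ≤ 1) (w y : Tor M) (ζ : Tor (fine n M) → ℝ)
    (hζ : cutInL n M ζ y)
    (h : ∀ (y₁ : Tor M) (ζ₁ : Tor (fine n M) → ℝ), cutInL n M ζ₁ y₁ →
      h2L n M a (.ten K) α ζ₁ ≤ C * Real.exp (-(δ₀ * distSite M y₁ w)) * cutHL n M α ζ₁ * N) :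
    holderT n M α (smulT n M ζ (ggrad n M s₁ ((DeltaA n M a)⁻¹ *ᵥ divT n M K)))
      ≤ (7 : ℝ) ^ d * (1 + B5CoverP12Lattice.Lw d) * C * Real.exp (3 * δ₀) * Real.exp (-(δ₀ * distSite M y w))
        * cutHL n M α ζ * N := by
  have h' : ∀ (y₁ : Tor M) (ζ₁ : Tor (fine n M) → ℝ), cutInL n M ζ₁ y₁ →
      holderT n M α (smulT n M ζ₁ (grad n M ((DeltaA n M a)⁻¹ *ᵥ divT n M K)))
        ≤ C * Real.exp (-(δ₀ * distSite M y₁ w)) * cutHL n M α ζ₁ * N := fun y₁ ζ₁ hc => by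
    simpa only [h2L] using h y₁ ζ₁ hc
  set A := (DeltaA n M a)⁻¹ *ᵥ divT n M K with hA
  have hL := B5CoverP12Lattice.Lw_nonneg d
  have hζ0 : 0 ≤ cutHL n M α ζ := cutHL_nonneg α ζ
  -- the bound for one translated, re-localised component
  set X : ℝ := C * Real.exp (3 * δ₀) * Real.exp (-(δ₀ * distSite M y w)) * ((1 + B5CoverP12Lattice.Lw d) * cutHL n M α ζ) * N
    with hX
  have hX0 : 0 ≤ X := by positivity
  have hbig_eq : (7 : ℝ) ^ d * (1 + B5CoverP12Lattice.Lw d) * C * Real.exp (3 * δ₀) * Real.exp (-(δ₀ * distSite M y w))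
      * cutHL n M α ζ * N = (7 : ℝ) ^ d * X := by rw [hX]; ring
  -- the un-translated bound is below the big constant
  have hsmall : C * Real.exp (-(δ₀ * distSite M y w)) * cutHL n M α ζ * N ≤ (7 : ℝ) ^ d * X := by
    have h7 : (1 : ℝ) ≤ (7 : ℝ) ^ d := one_le_pow₀ (by norm_num)
    have he : (1 : ℝ) ≤ Real.exp (3 * δ₀) := Real.one_le_exp (by positivity)
    have hw : (1 : ℝ) ≤ 1 + B5CoverP12Lattice.Lw d := by linarith
    have base : 0 ≤ C * Real.exp (-(δ₀ * distSite M y w)) * cutHL n M α ζ * N := by positivity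
    calc C * Real.exp (-(δ₀ * distSite M y w)) * cutHL n M α ζ * N
        = 1 * 1 * 1 * (C * Real.exp (-(δ₀ * distSite M y w)) * cutHL n M α ζ * N) := by ring
      _ ≤ (7 : ℝ) ^ d * Real.exp (3 * δ₀) * (1 + B5CoverP12Lattice.Lw d)
          * (C * Real.exp (-(δ₀ * distSite M y w)) * cutHL n M α ζ * N) := by gcongr
      _ = (7 : ℝ) ^ d * X := by rw [hX]; ring
  -- the translated cut-off, re-localised: the sum over labels of the (1.113) bounds
  have hshift : ∀ μ : Fin d, holderT n M α (smulT n M (shiftCut μ ζ) (grad n M A)) ≤ (7 : ℝ) ^ d * X := by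
    intro μ
    have hsum : holderT n M α (smulT n M (shiftCut μ ζ) (grad n M A))
        ≤ ∑ y₁ : Tor M, holderT n M α (smulT n M (locCut y₁ (shiftCut μ ζ)) (grad n M A)) := by
      unfold holderT holderSeminormB5
      rw [smulT_eq_sum_locCut hM2 (shiftCut μ ζ) (grad n M A)]
      have e : (fun p : Fin d × (Tor (fine n M) × Fin d) =>
          (∑ y₁ : Tor M, smulT n M (locCut y₁ (shiftCut μ ζ)) (grad n M A)) p.1 p.2)
          = ∑ y₁ : Tor M, fun p : Fin d × (Tor (fine n M) × Fin d) => smulT n M (locCut y₁ (shiftCut μ ζ)) (grad n M A) p.1 p.2 := by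
        funext p; simp only [Finset.sum_apply]
      rw [e]
      exact holderSeminorm_sum_le _ _ _ _ _ _
    refine hsum.trans (sum_near_le hX0 y fun y₁ => ?_)
    have hT := h' y₁ (locCut y₁ (shiftCut μ ζ)) (cutInL_locCut hn y₁ _)
    by_cases hzero : ∀ z, locCut y₁ (shiftCut μ ζ) z = 0
    · have hc0 : cutHL n M α (locCut y₁ (shiftCut μ ζ)) ≤ 0 := cutHL_le_zero_of_forall_eq_zero hzero α
      have : C * Real.exp (-(δ₀ * distSite M y₁ w)) * cutHL n M α (locCut y₁ (shiftCut μ ζ)) * N ≤ 0 := by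
        have : 0 ≤ C * Real.exp (-(δ₀ * distSite M y₁ w)) * N := by positivity
        nlinarith
      refine hT.trans (this.trans ?_)
      split_ifs <;> positivity
    · push Not at hzero
      obtain ⟨z, hz⟩ := hzero
      have hd3 : distSite M y y₁ ≤ 3 := by
        rw [B5RowSumsP12Lattice.distSite_comm]
        exact distSite_le_three_of_locCut_ne hn hζ μ hz
      rw [if_pos hd3]
      have htri : distSite M y w ≤ 3 + distSite M y₁ w :=
        (B5RowSumsP12Lattice.distSite_triangle M y y₁ w).trans (by linarith)
      have hexp : Real.exp (-(δ₀ * distSite M y₁ w)) ≤ Real.exp (3 * δ₀) * Real.exp (-(δ₀ * distSite M y w)) := by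
        rw [← Real.exp_add]
        exact Real.exp_le_exp.mpr (by nlinarith)
      have hcut : cutHL n M α (locCut y₁ (shiftCut μ ζ)) ≤ (1 + B5CoverP12Lattice.Lw d) * cutHL n M α ζ :=
        (cutHL_locCut_le hn hM2 y₁ hα _).trans (mul_le_mul_of_nonneg_left (cutHL_shiftCut_le μ α ζ) (by linarith))
      refine hT.trans ?_
      have hstep : C * Real.exp (-(δ₀ * distSite M y₁ w)) * cutHL n M α (locCut y₁ (shiftCut μ ζ))
          ≤ C * (Real.exp (3 * δ₀) * Real.exp (-(δ₀ * distSite M y w))) * ((1 + B5CoverP12Lattice.Lw d) * cutHL n M α ζ) :=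
        mul_le_mul (mul_le_mul_of_nonneg_left hexp hC) hcut (cutHL_nonneg α _) (by positivity)
      calc C * Real.exp (-(δ₀ * distSite M y₁ w)) * cutHL n M α (locCut y₁ (shiftCut μ ζ)) * N
          ≤ C * (Real.exp (3 * δ₀) * Real.exp (-(δ₀ * distSite M y w))) * ((1 + B5CoverP12Lattice.Lw d) * cutHL n M α ζ) * N :=
            mul_le_mul_of_nonneg_right hstep hN
        _ = X := by rw [hX]; ring
  -- now the Hölder quotients of `ζ·D₁A`, pair by pair
  rw [hbig_eq]
  have h7X : 0 ≤ (7 : ℝ) ^ d * X := by positivity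
  unfold holderT holderSeminormB5
  refine holderSeminorm_le h7X fun p _ p' _ hadm hpos => ?_
  obtain ⟨⟨hμ, hκ⟩, hle1⟩ := hadm
  obtain ⟨μ, x, κ⟩ := p
  obtain ⟨μ', x', κ'⟩ := p'
  simp only at hμ hκ hle1 hpos
  subst hμ; subst hκ
  rw [id]
  set t := distU n M x x' with ht
  have htα0 : 0 ≤ t ^ α := Real.rpow_nonneg hpos.le α
  cases h1 : s₁ μ with
  | true =>
      -- forward component: the printed (1.113) entry itself
      have ev : ∀ b : Tor (fine n M) × Fin d, smulT n M ζ (ggrad n M s₁ A) μ b = smulT n M ζ (grad n M A) μ b := fun b => by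
        simp only [smulT, ggrad_apply_of_true A h1]
      rw [ev, ev]
      have hb := holder_bound (α := α) (adm := fun q q' : Fin d × (Tor (fine n M) × Fin d) =>
          (q.1 = q'.1 ∧ q.2.2 = q'.2.2) ∧ distU n M q.2.1 q'.2.1 ≤ 1)
        (dist := fun q q' => distU n M q.2.1 q'.2.1) (τ := fun _ _ => id) (S := Finset.univ)
        (fun q : Fin d × (Tor (fine n M) × Fin d) => smulT n M ζ (grad n M A) q.1 q.2) (x := (μ, (x, κ))) (x' := (μ, (x', κ)))
        (Finset.mem_univ _) (Finset.mem_univ _) ⟨⟨rfl, rfl⟩, hle1⟩ hpos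
      rw [id] at hb
      refine hb.trans ?_
      refine mul_le_mul_of_nonneg_right ((h' y ζ hζ).trans hsmall) htα0
  | false =>
      -- adjoint component: translate by one fine step and re-localise the translated cut-off
      have ev : ∀ u : Tor (fine n M), smulT n M ζ (ggrad n M s₁ A) μ (u, κ)
          = -(smulT n M (shiftCut μ ζ) (grad n M A) μ (u - unitVec (fine n M) μ, κ)) := fun u => by
        simp only [smulT, ggrad_apply_of_false A h1, shiftCut, sub_add_cancel, mul_neg]
      rw [ev, ev, neg_sub_neg, norm_sub_rev]
      have hd : distU n M (x - unitVec (fine n M) μ) (x' - unitVec (fine n M) μ) = t := distU_sub_right _ _ _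
      have hb := holder_bound (α := α) (adm := fun q q' : Fin d × (Tor (fine n M) × Fin d) =>
          (q.1 = q'.1 ∧ q.2.2 = q'.2.2) ∧ distU n M q.2.1 q'.2.1 ≤ 1)
        (dist := fun q q' => distU n M q.2.1 q'.2.1) (τ := fun _ _ => id) (S := Finset.univ)
        (fun q : Fin d × (Tor (fine n M) × Fin d) => smulT n M (shiftCut μ ζ) (grad n M A) q.1 q.2)
        (x := (μ, (x - unitVec (fine n M) μ, κ))) (x' := (μ, (x' - unitVec (fine n M) μ, κ)))
        (Finset.mem_univ _) (Finset.mem_univ _) ⟨⟨rfl, rfl⟩, by rw [hd]; exact hle1⟩ (by rw [hd]; exact hpos)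
      rw [id, hd] at hb
      exact hb.trans (mul_le_mul_of_nonneg_right (hshift μ) htα0)

end OuterHolder

/-! ## §6 Real sources, the pieces of the translated source, and the assembled bounds on one torus -/

section Assembly

variable {n : ℕ} [NeZero n] {M : Fin d → ℕ} [hM : ∀ μ, NeZero (M μ)] {a : ℝ}

/-- the embedding of a REAL tensor source (the sources of the family of record `famG` are real: `B5SettingP12Real.LocR`).
[cite: Balaban1984PropagatorsI, Prop. 1.2 (1.112) p.36] -/
def embT (Jr : Fin d → (Tor (fine n M) × Fin d → ℝ)) : Fin d → (Tor (fine n M) × Fin d → ℂ) := fun s b => (Jr s b : ℂ)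

omit [NeZero n] hM in
/-- `(LocR.ten Jr).emb = .ten (embT Jr)` (definitional). [cite: Balaban1984PropagatorsI, Prop. 1.2 (1.112) p.36] -/
theorem emb_ten (Jr : Fin d → (Tor (fine n M) × Fin d → ℝ)) : (B5SettingP12Real.LocR.ten Jr).emb = .ten (embT Jr) := rfl

/-- the translated source at the real level. [cite: Balaban1984PropagatorsI, p.36 (remark after (1.114))] -/
def sharpR (s₂ : Fin d → Bool) (Jr : Fin d → (Tor (fine n M) × Fin d → ℝ)) : Fin d → (Tor (fine n M) × Fin d → ℝ) :=
  fun ν b => if s₂ ν then -(Jr ν (nb n M ν b)) else Jr ν b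

omit [NeZero n] hM in
/-- `embT (sharpR J) = (embT J)♯`. [cite: Balaban1984PropagatorsI, p.36 (remark after (1.114))] -/
theorem embT_sharpR (s₂ : Fin d → Bool) (Jr : Fin d → (Tor (fine n M) × Fin d → ℝ)) :
    embT (sharpR s₂ Jr) = sharp n M s₂ (embT Jr) := by
  funext ν b
  by_cases h : s₂ ν = true
  · simp [embT, sharpR, sharp, h]
  · simp [embT, sharpR, sharp, h]

/-- the unit-scale pieces at the real level: `ζ′_w·K`. [cite: Balaban1984PropagatorsI, (1.118) p.36, (1.115)–(1.117) p.36] -/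
def pieceRT (w : Tor M) (Kr : Fin d → (Tor (fine n M) × Fin d → ℝ)) : Fin d → (Tor (fine n M) × Fin d → ℝ) :=
  fun s b => B5CoverP12Lattice.wP M n w b.1 * Kr s b

omit [NeZero n] in
/-- `embT (ζ′_w·K) = ζ′_w·(embT K)`. [cite: Balaban1984PropagatorsI, (1.118) p.36] -/
theorem embT_pieceRT (w : Tor M) (Kr : Fin d → (Tor (fine n M) × Fin d → ℝ)) :
    embT (pieceRT w Kr) = smulT n M (B5CoverP12Lattice.wP M n w) (embT Kr) := by
  funext s b
  simp [embT, pieceRT, smulT, Complex.ofReal_mul]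

/-- **pieces of the translated source far from `y′` vanish**: if `supp J ⊂ Δ̃(y′)` and `|w − y′| > 3` then `ζ′_w·J♯ = 0`.
[cite: Balaban1984PropagatorsI, p.35 (the cubes Δ̃(y)), (1.118) p.36] -/
theorem piece_sharp_eq_zero_of_far (hn : 1 ≤ n) {J : Fin d → (Tor (fine n M) × Fin d → ℂ)} {y' : Tor M}
    (hJ : suppInL n M (.ten J) y') (s₂ : Fin d → Bool) {w : Tor M} (hfar : ¬ distSite M w y' ≤ 3) :
    smulT n M (B5CoverP12Lattice.wP M n w) (sharp n M s₂ J) = 0 := by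
  funext ν b
  show ((B5CoverP12Lattice.wP M n w b.1 : ℝ) : ℂ) * sharp n M s₂ J ν b = 0
  by_cases hw : B5CoverP12Lattice.wP M n w b.1 = 0
  · rw [hw, Complex.ofReal_zero, zero_mul]
  · by_cases hs : sharp n M s₂ J ν b = 0
    · rw [hs, mul_zero]
    · exfalso
      apply hfar
      have hxw : b.1 ∈ cubeT n M w := B5CoverP12Lattice.mem_cubeT_of_wP_ne_zero M n hn hw
      rcases sharp_supp hJ s₂ ν b hs with h | h
      · exact distSite_le_three_of_mem hn hxw h
      · exact distSite_le_three_of_nb hn ν hxw h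

omit hM in
/-- `A(Σ_i v_i) = Σ_i Av_i`. [folklore] -/
private theorem mulVec_finset_sum {m m' : Type*} [Fintype m] {κ : Type*} (A : Matrix m' m ℂ) (s : Finset κ)
    (v : κ → m → ℂ) : A *ᵥ (∑ i ∈ s, v i) = ∑ i ∈ s, A *ᵥ v i := by
  have h := map_sum (Matrix.mulVecLin A) v s
  simp only [Matrix.mulVecLin_apply] at h
  exact h

/-- linearity of the generalised gradient over finite sums, flattened. [cite: Balaban1984PropagatorsI, (1.31) p.23] -/
theorem flat_ggrad_sum {κ : Type*} (s : Finset κ) (s₁ : Fin d → Bool) (v : κ → Tor (fine n M) × Fin d → ℂ) :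
    (fun p : Fin d × (Tor (fine n M) × Fin d) => ggrad n M s₁ (∑ i ∈ s, v i) p.1 p.2)
      = ∑ i ∈ s, fun p : Fin d × (Tor (fine n M) × Fin d) => ggrad n M s₁ (v i) p.1 p.2 := by
  funext p
  simp only [ggrad, mulVec_finset_sum, Finset.sum_apply]

/-- the same inside a cut-off product. [cite: Balaban1984PropagatorsI, Prop. 1.2 (1.113) p.36] -/
theorem flat_smulT_ggrad_sum {κ : Type*} (s : Finset κ) (ζ : Tor (fine n M) → ℝ) (s₁ : Fin d → Bool)
    (v : κ → Tor (fine n M) × Fin d → ℂ) :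
    (fun p : Fin d × (Tor (fine n M) × Fin d) => smulT n M ζ (ggrad n M s₁ (∑ i ∈ s, v i)) p.1 p.2)
      = ∑ i ∈ s, fun p : Fin d × (Tor (fine n M) × Fin d) => smulT n M ζ (ggrad n M s₁ (v i)) p.1 p.2 := by
  funext p
  simp only [smulT, ggrad, mulVec_finset_sum, Finset.sum_apply, Finset.mul_sum]

/-- `G∇*0 = 0`, hence the generalised gradient field of the zero source vanishes. [cite: Balaban1984PropagatorsI, (1.71) p.30] -/
theorem ggrad_G_divT_zero (s₁ : Fin d → Bool) (μ : Fin d) (b : Tor (fine n M) × Fin d) :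
    ggrad n M s₁ ((DeltaA n M a)⁻¹ *ᵥ divT n M (0 : Fin d → (Tor (fine n M) × Fin d → ℂ))) μ b = 0 := by
  have h0 : divT n M (0 : Fin d → (Tor (fine n M) × Fin d → ℂ)) = 0 := by
    unfold divT; simp [Matrix.mulVec_zero]
  rw [h0, Matrix.mulVec_zero]
  simp [ggrad, Matrix.mulVec_zero]

/-- **THE (1.112)-TYPE BOUND FOR ARBITRARY DERIVATIVES ON ONE TORUS**, from the printed (1.112) for all REAL tensor sources on
that torus: `sup_{x∈Δ̃(y)} |(D₁GD₂J)(x)| ≤ 7^d (max(1,L_w) + 1) C e^{6δ₀} · e^{−δ₀|y−y′|}(‖J‖_ε + |J|)` for `supp J ⊂ Δ̃(y′)`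
(tori with `≥ 2` unit cubes per direction). Mechanism: `D₂J = ∇*J♯` (inner conversion), `J♯ = Σ_{|w−y′|≤3} ζ′_wJ♯` (unit-scale
re-localisation with `‖ζ′_wJ♯‖_ε ≤ max(1,L_w)(‖J‖_ε + |J|)`), the outer conversion on each piece, `|w − y′| ≤ 3 ⇒
e^{−δ₀|y−w|} ≤ e^{3δ₀}e^{−δ₀|y−y′|}`. [cite: Balaban1984PropagatorsI, p.36 (remark after (1.114)), (1.112) p.36] -/
theorem e4G_le (hn : 1 ≤ n) (hM2 : ∀ μ, 2 ≤ M μ) (s₁ s₂ : Fin d → Bool) {C δ₀ ε : ℝ} (hC : 0 ≤ C) (hδ : 0 ≤ δ₀)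
    (hε0 : 0 < ε) (hε1 : ε < 1)
    (h112 : ∀ (Kr : Fin d → (Tor (fine n M) × Fin d → ℝ)) (y₁ w : Tor M), suppInL n M (.ten (embT Kr)) w →
      e4L n M a (.ten (embT Kr)) y₁ ≤ C * Real.exp (-(δ₀ * distSite M y₁ w))
        * (holderL n M ε (.ten (embT Kr)) + supNormL n M (.ten (embT Kr))))
    (Jr : Fin d → (Tor (fine n M) × Fin d → ℝ)) {y y' : Tor M} (hJ : suppInL n M (.ten (embT Jr)) y') :
    e4G n M a s₁ s₂ (embT Jr) y ≤ (7 : ℝ) ^ d * (max 1 (B5CoverP12Lattice.Lw d) + 1) * C * Real.exp (6 * δ₀)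
      * Real.exp (-(δ₀ * distSite M y y')) * (holderL n M ε (.ten (embT Jr)) + supNormL n M (.ten (embT Jr))) := by
  set H := holderL n M ε (.ten (embT Jr)) + supNormL n M (.ten (embT Jr)) with hH
  have hH0 : 0 ≤ H := add_nonneg (holderL_nonneg ε _) (supNormL_nonneg _)
  set cP : ℝ := max 1 (B5CoverP12Lattice.Lw d) + 1 with hcP
  have hcP0 : 0 ≤ cP := by rw [hcP]; positivity
  -- the translated source and its pieces
  set K := sharp n M s₂ (embT Jr) with hK
  have hKsupp : suppInL n M (.ten (embT Jr)) y' := hJ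
  -- norms of the translated source
  have hKn : holderL n M ε (.ten K) + supNormL n M (.ten K) ≤ H :=
    add_le_add (holder_sharp_le s₂ (embT Jr) ε) (supNorm_sharp_le s₂ (embT Jr))
  -- the per-piece bound
  set X : ℝ := C * Real.exp (6 * δ₀) * Real.exp (-(δ₀ * distSite M y y')) * (cP * H) with hX
  have hX0 : 0 ≤ X := by positivity
  have hterm : ∀ w : Tor M, supNorm (Finset.univ ×ˢ cubeB n M y)
      (fun p : Fin d × (Tor (fine n M) × Fin d) =>
        ggrad n M s₁ ((DeltaA n M a)⁻¹ *ᵥ divT n M (smulT n M (B5CoverP12Lattice.wP M n w) K)) p.1 p.2)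
      ≤ if distSite M y' w ≤ 3 then X else 0 := by
    intro w
    by_cases hnear : distSite M w y' ≤ 3
    · rw [if_pos (by rwa [B5RowSumsP12Lattice.distSite_comm])]
      -- the piece is a real source supported in Δ̃(w)
      have hpiece : smulT n M (B5CoverP12Lattice.wP M n w) K = embT (pieceRT w (sharpR s₂ Jr)) := by
        rw [embT_pieceRT, embT_sharpR]
      have hsuppw : suppInL n M (.ten (embT (pieceRT w (sharpR s₂ Jr)))) w := by
        rw [← hpiece]; exact piece_supp M n w (.ten K)
      have hNw : holderL n M ε (.ten (embT (pieceRT w (sharpR s₂ Jr)))) + supNormL n M (.ten (embT (pieceRT w (sharpR s₂ Jr))))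
          ≤ cP * H := by
        rw [← hpiece]
        have h1 := piece_holder M n hM2 ε (.ten K) w hε0 hε1
        have h2 := piece_sup M n w (.ten K)
        have hm : (1 : ℝ) ≤ max 1 (B5CoverP12Lattice.Lw d) := le_max_left _ _
        have hKn0 : 0 ≤ supNormL n M (.ten K) := supNormL_nonneg _
        have hKh0 : 0 ≤ holderL n M ε (.ten K) := holderL_nonneg ε _
        calc holderL n M ε (pieceL M n w (.ten K)) + supNormL n M (pieceL M n w (.ten K))
            ≤ max 1 (B5CoverP12Lattice.Lw d) * (holderL n M ε (.ten K) + supNormL n M (.ten K)) + supNormL n M (.ten K) :=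
              add_le_add h1 h2
          _ ≤ max 1 (B5CoverP12Lattice.Lw d) * H + 1 * H := by
              refine add_le_add (mul_le_mul_of_nonneg_left hKn (by positivity)) ?_
              rw [one_mul]; exact le_trans (le_add_of_nonneg_left hKh0) hKn
          _ = cP * H := by rw [hcP]; ring
      have hb := sup_ggrad_le (a := a) hn s₁ (embT (pieceRT w (sharpR s₂ Jr))) hC hδ (by positivity : 0 ≤ cP * H) w y
        (fun y₁ => (h112 _ y₁ w hsuppw).trans (mul_le_mul_of_nonneg_left hNw (by positivity)))
      rw [← hpiece] at hb
      refine hb.trans ?_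
      have htri : distSite M y y' ≤ distSite M y w + 3 :=
        (B5RowSumsP12Lattice.distSite_triangle M y w y').trans (by linarith)
      have hexp : Real.exp (3 * δ₀) * Real.exp (-(δ₀ * distSite M y w)) ≤ Real.exp (6 * δ₀) * Real.exp (-(δ₀ * distSite M y y')) := by
        rw [← Real.exp_add, ← Real.exp_add]
        exact Real.exp_le_exp.mpr (by nlinarith)
      calc C * Real.exp (3 * δ₀) * Real.exp (-(δ₀ * distSite M y w)) * (cP * H)
          = C * (Real.exp (3 * δ₀) * Real.exp (-(δ₀ * distSite M y w))) * (cP * H) := by ring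
        _ ≤ C * (Real.exp (6 * δ₀) * Real.exp (-(δ₀ * distSite M y y'))) * (cP * H) :=
          mul_le_mul_of_nonneg_right (mul_le_mul_of_nonneg_left hexp hC) (by positivity)
        _ = X := by rw [hX]; ring
    · rw [piece_sharp_eq_zero_of_far hn hJ s₂ hnear]
      have h0 : (fun p : Fin d × (Tor (fine n M) × Fin d) =>
          ggrad n M s₁ ((DeltaA n M a)⁻¹ *ᵥ divT n M (0 : Fin d → (Tor (fine n M) × Fin d → ℂ))) p.1 p.2)
          = fun _ => (0 : ℂ) := by
        funext p; exact ggrad_G_divT_zero s₁ p.1 p.2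
      rw [h0, LatticeNorms.supNorm_zero]
      split_ifs <;> positivity
  -- assemble
  have hdec : (fun p : Fin d × (Tor (fine n M) × Fin d) => fieldG n M a s₁ s₂ (embT Jr) p.1 p.2)
      = ∑ w : Tor M, fun p : Fin d × (Tor (fine n M) × Fin d) =>
          ggrad n M s₁ ((DeltaA n M a)⁻¹ *ᵥ divT n M (smulT n M (B5CoverP12Lattice.wP M n w) K)) p.1 p.2 := by
    unfold fieldG
    rw [gdiv_eq_divT_sharp, ← hK]
    conv_lhs => rw [← sum_pieces_ten M n hM2 K]
    rw [divT_sum, mulVec_finset_sum, flat_ggrad_sum]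
  unfold e4G
  rw [hdec]
  refine (supNorm_sum_le _ _ _).trans ((sum_near_le hX0 y' hterm).trans (le_of_eq ?_))
  rw [hX]; ring

/-- **THE (1.113)-TYPE BOUND FOR ARBITRARY DERIVATIVES ON ONE TORUS**, from the printed (1.113) for all REAL tensor sources on that
torus: `‖ζD₁GD₂J‖_α ≤ 49^d (1 + L_w)(max(1,L_w) + 1) C e^{6δ₀} · e^{−δ₀|y−y′|}(‖ζ‖_α + |ζ|)(‖J‖_{α+ε} + |J|)` for `supp ζ ⊂ Δ̃(y)`,
`supp J ⊂ Δ̃(y′)`, `0 ≤ α`, `0 < ε`, `α + ε < 1` (tori with `≥ 2` unit cubes per direction). Same mechanism as `e4G_le`, with the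
outer conversion `holder_ggrad_le`. [cite: Balaban1984PropagatorsI, p.36 (remark after (1.114)), (1.113) p.36] -/
theorem h2G_le (hn : 1 ≤ n) (hM2 : ∀ μ, 2 ≤ M μ) (s₁ s₂ : Fin d → Bool) {C δ₀ α ε : ℝ} (hC : 0 ≤ C) (hδ : 0 ≤ δ₀)
    (hα : 0 ≤ α) (hε0 : 0 < ε) (hαε : α + ε < 1)
    (h113 : ∀ (Kr : Fin d → (Tor (fine n M) × Fin d → ℝ)) (y₁ w : Tor M) (ζ₁ : Tor (fine n M) → ℝ),
      cutInL n M ζ₁ y₁ → suppInL n M (.ten (embT Kr)) w →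
      h2L n M a (.ten (embT Kr)) α ζ₁ ≤ C * Real.exp (-(δ₀ * distSite M y₁ w)) * cutHL n M α ζ₁
        * (holderL n M (α + ε) (.ten (embT Kr)) + supNormL n M (.ten (embT Kr))))
    (Jr : Fin d → (Tor (fine n M) × Fin d → ℝ)) {y y' : Tor M} (ζ : Tor (fine n M) → ℝ) (hζ : cutInL n M ζ y)
    (hJ : suppInL n M (.ten (embT Jr)) y') :
    h2G n M a s₁ s₂ (embT Jr) α ζ ≤ (49 : ℝ) ^ d * (1 + B5CoverP12Lattice.Lw d) * (max 1 (B5CoverP12Lattice.Lw d) + 1) * C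
      * Real.exp (6 * δ₀) * Real.exp (-(δ₀ * distSite M y y')) * cutHL n M α ζ
      * (holderL n M (α + ε) (.ten (embT Jr)) + supNormL n M (.ten (embT Jr))) := by
  set H := holderL n M (α + ε) (.ten (embT Jr)) + supNormL n M (.ten (embT Jr)) with hH
  have hH0 : 0 ≤ H := add_nonneg (holderL_nonneg (α + ε) _) (supNormL_nonneg _)
  set cP : ℝ := max 1 (B5CoverP12Lattice.Lw d) + 1 with hcP
  have hcP0 : 0 ≤ cP := by rw [hcP]; positivity
  have hL := B5CoverP12Lattice.Lw_nonneg d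
  have hζ0 : 0 ≤ cutHL n M α ζ := cutHL_nonneg α ζ
  have hα1 : α ≤ 1 := by linarith
  set K := sharp n M s₂ (embT Jr) with hK
  have hKn : holderL n M (α + ε) (.ten K) + supNormL n M (.ten K) ≤ H :=
    add_le_add (holder_sharp_le s₂ (embT Jr) (α + ε)) (supNorm_sharp_le s₂ (embT Jr))
  set X : ℝ := (7 : ℝ) ^ d * (1 + B5CoverP12Lattice.Lw d) * C * Real.exp (6 * δ₀) * Real.exp (-(δ₀ * distSite M y y'))
    * cutHL n M α ζ * (cP * H) with hX
  have hX0 : 0 ≤ X := by positivity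
  have hterm : ∀ w : Tor M, holderT n M α (smulT n M ζ
      (ggrad n M s₁ ((DeltaA n M a)⁻¹ *ᵥ divT n M (smulT n M (B5CoverP12Lattice.wP M n w) K))))
      ≤ if distSite M y' w ≤ 3 then X else 0 := by
    intro w
    by_cases hnear : distSite M w y' ≤ 3
    · rw [if_pos (by rwa [B5RowSumsP12Lattice.distSite_comm])]
      have hpiece : smulT n M (B5CoverP12Lattice.wP M n w) K = embT (pieceRT w (sharpR s₂ Jr)) := by
        rw [embT_pieceRT, embT_sharpR]
      have hsuppw : suppInL n M (.ten (embT (pieceRT w (sharpR s₂ Jr)))) w := by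
        rw [← hpiece]; exact piece_supp M n w (.ten K)
      have hNw : holderL n M (α + ε) (.ten (embT (pieceRT w (sharpR s₂ Jr))))
          + supNormL n M (.ten (embT (pieceRT w (sharpR s₂ Jr)))) ≤ cP * H := by
        rw [← hpiece]
        have h1 := piece_holder M n hM2 (α + ε) (.ten K) w (by linarith) hαε
        have h2 := piece_sup M n w (.ten K)
        have hKn0 : 0 ≤ supNormL n M (.ten K) := supNormL_nonneg _
        have hKh0 : 0 ≤ holderL n M (α + ε) (.ten K) := holderL_nonneg (α + ε) _
        calc holderL n M (α + ε) (pieceL M n w (.ten K)) + supNormL n M (pieceL M n w (.ten K))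
            ≤ max 1 (B5CoverP12Lattice.Lw d) * (holderL n M (α + ε) (.ten K) + supNormL n M (.ten K)) + supNormL n M (.ten K) :=
              add_le_add h1 h2
          _ ≤ max 1 (B5CoverP12Lattice.Lw d) * H + 1 * H := by
              refine add_le_add (mul_le_mul_of_nonneg_left hKn (by positivity)) ?_
              rw [one_mul]; exact le_trans (le_add_of_nonneg_left hKh0) hKn
          _ = cP * H := by rw [hcP]; ring
      have hb := holder_ggrad_le (a := a) hn hM2 s₁ (embT (pieceRT w (sharpR s₂ Jr))) hC hδ (by positivity : 0 ≤ cP * H)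
        hα1 w y ζ hζ (fun y₁ ζ₁ hc => (h113 _ y₁ w ζ₁ hc hsuppw).trans
          (mul_le_mul_of_nonneg_left hNw (mul_nonneg (by positivity) (cutHL_nonneg α ζ₁))))
      rw [← hpiece] at hb
      refine hb.trans ?_
      have htri : distSite M y y' ≤ distSite M y w + 3 :=
        (B5RowSumsP12Lattice.distSite_triangle M y w y').trans (by linarith)
      have hexp : Real.exp (3 * δ₀) * Real.exp (-(δ₀ * distSite M y w)) ≤ Real.exp (6 * δ₀) * Real.exp (-(δ₀ * distSite M y y')) := by
        rw [← Real.exp_add, ← Real.exp_add]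
        exact Real.exp_le_exp.mpr (by nlinarith)
      have hc7 : 0 ≤ (7 : ℝ) ^ d * (1 + B5CoverP12Lattice.Lw d) * C := by positivity
      calc (7 : ℝ) ^ d * (1 + B5CoverP12Lattice.Lw d) * C * Real.exp (3 * δ₀) * Real.exp (-(δ₀ * distSite M y w))
            * cutHL n M α ζ * (cP * H)
          = (7 : ℝ) ^ d * (1 + B5CoverP12Lattice.Lw d) * C * (Real.exp (3 * δ₀) * Real.exp (-(δ₀ * distSite M y w)))
            * (cutHL n M α ζ * (cP * H)) := by ring
        _ ≤ (7 : ℝ) ^ d * (1 + B5CoverP12Lattice.Lw d) * C * (Real.exp (6 * δ₀) * Real.exp (-(δ₀ * distSite M y y')))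
            * (cutHL n M α ζ * (cP * H)) :=
          mul_le_mul_of_nonneg_right (mul_le_mul_of_nonneg_left hexp hc7) (by positivity)
        _ = X := by rw [hX]; ring
    · rw [piece_sharp_eq_zero_of_far hn hJ s₂ hnear]
      have h0 : (fun p : Fin d × (Tor (fine n M) × Fin d) => smulT n M ζ
          (ggrad n M s₁ ((DeltaA n M a)⁻¹ *ᵥ divT n M (0 : Fin d → (Tor (fine n M) × Fin d → ℂ)))) p.1 p.2)
          = fun _ => (0 : ℂ) := by
        funext p; simp only [smulT, ggrad_G_divT_zero s₁ p.1 p.2, mul_zero]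
      have hle0 : holderT n M α (smulT n M ζ
          (ggrad n M s₁ ((DeltaA n M a)⁻¹ *ᵥ divT n M (0 : Fin d → (Tor (fine n M) × Fin d → ℂ))))) ≤ 0 := by
        unfold holderT holderSeminormB5
        rw [h0]
        exact holderSeminorm_le le_rfl fun _ _ _ _ _ _ => by rw [id, sub_zero, norm_zero, zero_mul]
      refine hle0.trans ?_
      split_ifs <;> positivity
  have hdec : (fun p : Fin d × (Tor (fine n M) × Fin d) => smulT n M ζ (fieldG n M a s₁ s₂ (embT Jr)) p.1 p.2)
      = ∑ w : Tor M, fun p : Fin d × (Tor (fine n M) × Fin d) =>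
          smulT n M ζ (ggrad n M s₁ ((DeltaA n M a)⁻¹ *ᵥ divT n M (smulT n M (B5CoverP12Lattice.wP M n w) K))) p.1 p.2 := by
    unfold fieldG
    rw [gdiv_eq_divT_sharp, ← hK]
    conv_lhs => rw [← sum_pieces_ten M n hM2 K]
    rw [divT_sum, mulVec_finset_sum, flat_smulT_ggrad_sum]
  have hbig : (49 : ℝ) ^ d * (1 + B5CoverP12Lattice.Lw d) * (max 1 (B5CoverP12Lattice.Lw d) + 1) * C
      * Real.exp (6 * δ₀) * Real.exp (-(δ₀ * distSite M y y')) * cutHL n M α ζ * H = (7 : ℝ) ^ d * X := by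
    rw [hX, hcP, show (49 : ℝ) ^ d = (7 : ℝ) ^ d * (7 : ℝ) ^ d by rw [← mul_pow]; norm_num]
    ring
  rw [hbig]
  unfold h2G holderT holderSeminormB5
  rw [hdec]
  refine (holderSeminorm_sum_le _ _ _ _ _ _).trans ?_
  exact sum_near_le hX0 y' hterm

end Assembly

/-! ## §7 The remark PROVED for the G-family of record `famG d L a` (Prop. 1.2 holds for it: `B5Prop12GHolds.prop12_famG_printed`) -/

section Family

open Literature.MathematicalPhysics.QuantumFieldTheory.Balaban1983to89.B5SiteBridgeP12 (nP MP one_le_nP two_le_MP)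
open Literature.MathematicalPhysics.QuantumFieldTheory.Balaban1983to89.B5Prop12GLattice (famG)
open Literature.MathematicalPhysics.QuantumFieldTheory.Balaban1983to89.B5ResidualGpTorusHolds (TopIdx)

/-- **THE p. 36 REMARK FOR BAŁABAN'S `G = Δ_a⁻¹` ON THE TORI OF RECORD** (p. 36 [PDF 20], after (1.114), verbatim: «Let us remark that in
the inequalities (1.112), (1.113) the choice of derivatives ∇G∇* is accidental; we can take arbitrary derivatives, like ∂_μG∂_ν,
∂*_μG∂_ν, ∂*_μG∂*_ν.»): for the family `famG d L a` of `B5Prop12GLattice` (every top-level torus `T_η`, `η = L^{−K}`, of a volume with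
`P.d = d`, `P.L = L`, `K ≥ 1`; `d ≥ 1`, `L > 1` odd, `a > 0`), for EVERY choice of derivative kinds `s₁` (outer, per component `μ`) and
`s₂` (inner, per component `ν`), and every real tensor source `J` with `supp J ⊂ Δ̃(y′)`:
`sup_{x∈Δ̃(y)} |(D₁GD₂J)(x)| ≤ C_ε e^{−δ₀|y−y′|}(‖J‖_ε + |J|)` (`0 < ε < 1`) and
`‖ζD₁GD₂J‖_α ≤ C_{α,ε} e^{−δ₀|y−y′|}(‖ζ‖_α + |ζ|)(‖J‖_{α+ε} + |J|)` (`0 ≤ α`, `0 < ε`, `α + ε < 1`, `supp ζ ⊂ Δ̃(y)`), with ONE `δ₀ > 0`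
(that of Prop. 1.2 for the family) and constants `C_ε = 7^d(max(1,L_w)+1)e^{6δ₀}·max(C_ε^{(1.112)}, 0)`,
`C_{α,ε} = 49^d(1+L_w)(max(1,L_w)+1)e^{6δ₀}·max(C_{α,ε}^{(1.113)}, 0)` chosen before the member.  Proof: `e4G_le`/`h2G_le` fed with
the (1.112)/(1.113) clauses of `B5Prop12GHolds.prop12_famG_printed` (p37 g7).
[cite: Balaban1984PropagatorsI, p.36 (remark after (1.114)), Prop. 1.2 (1.112)–(1.113) p.36] -/
theorem remark36_famG {d L : ℕ} (hd : 1 ≤ d) (hL : Odd L ∧ 1 < L) {a : ℝ} (ha : 0 < a) :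
    ∃ δ₀ : ℝ, ∃ Cε : ℝ → ℝ, ∃ Cαε : ℝ → ℝ → ℝ, 0 < δ₀ ∧ (∀ ε, 0 ≤ Cε ε) ∧ (∀ α ε, 0 ≤ Cαε α ε) ∧
      ∀ (i : TopIdx d L) (s₁ s₂ : Fin i.P.d → Bool),
        (∀ (ε : ℝ) (J : Fin i.P.d → (Tor (fine (nP i.P) (MP i.P)) × Fin i.P.d → ℝ)) (y y' : Tor (MP i.P)),
            0 < ε → ε < 1 → suppInL (nP i.P) (MP i.P) (.ten (embT J)) y' →
            e4G (nP i.P) (MP i.P) a s₁ s₂ (embT J) y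
              ≤ Cε ε * Real.exp (-(δ₀ * distSite (MP i.P) y y'))
                * (holderL (nP i.P) (MP i.P) ε (.ten (embT J)) + supNormL (nP i.P) (MP i.P) (.ten (embT J)))) ∧
        (∀ (α ε : ℝ) (J : Fin i.P.d → (Tor (fine (nP i.P) (MP i.P)) × Fin i.P.d → ℝ)) (ζ : Tor (fine (nP i.P) (MP i.P)) → ℝ)
            (y y' : Tor (MP i.P)), 0 ≤ α → 0 < ε → α + ε < 1 →
            cutInL (nP i.P) (MP i.P) ζ y → suppInL (nP i.P) (MP i.P) (.ten (embT J)) y' →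
            h2G (nP i.P) (MP i.P) a s₁ s₂ (embT J) α ζ
              ≤ Cαε α ε * Real.exp (-(δ₀ * distSite (MP i.P) y y')) * cutHL (nP i.P) (MP i.P) α ζ
                * (holderL (nP i.P) (MP i.P) (α + ε) (.ten (embT J)) + supNormL (nP i.P) (MP i.P) (.ten (embT J)))) := by
  obtain ⟨δ₀, C, Cα, Cε, Cαε, hδ, hC, H⟩ := B5Prop12GHolds.prop12_famG_printed hd hL ha
  refine ⟨δ₀, fun ε => (7 : ℝ) ^ d * (max 1 (B5CoverP12Lattice.Lw d) + 1) * max (Cε ε) 0 * Real.exp (6 * δ₀),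
    fun α ε => (49 : ℝ) ^ d * (1 + B5CoverP12Lattice.Lw d) * (max 1 (B5CoverP12Lattice.Lw d) + 1) * max (Cαε α ε) 0
      * Real.exp (6 * δ₀), hδ, fun ε => ?_, fun α ε => ?_, ?_⟩
  · have := B5CoverP12Lattice.Lw_nonneg d; positivity
  · have := B5CoverP12Lattice.Lw_nonneg d; positivity
  intro i s₁ s₂
  obtain ⟨P, hPd, hPL, hK⟩ := i
  subst hPd
  have Hi := H ⟨P, rfl, hPL, hK⟩
  simp only [famG] at Hi
  obtain ⟨-, -, H112, H113, -⟩ := Hi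
  have hn : 1 ≤ nP P := one_le_nP P
  have hM2 : ∀ μ, 2 ≤ MP P μ := two_le_MP P
  constructor
  · intro ε J y y' hε0 hε1 hJ
    have h112 : ∀ (Kr : Fin P.d → (Tor (fine (nP P) (MP P)) × Fin P.d → ℝ)) (y₁ w : Tor (MP P)),
        suppInL (nP P) (MP P) (.ten (embT Kr)) w →
        e4L (nP P) (MP P) a (.ten (embT Kr)) y₁ ≤ max (Cε ε) 0 * Real.exp (-(δ₀ * distSite (MP P) y₁ w))
          * (holderL (nP P) (MP P) ε (.ten (embT Kr)) + supNormL (nP P) (MP P) (.ten (embT Kr))) := by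
      intro Kr y₁ w hw
      have h := H112 ε (B5SettingP12Real.LocR.ten Kr) y₁ w hε0 hε1 hw
      refine h.trans (mul_le_mul_of_nonneg_right (mul_le_mul_of_nonneg_right (le_max_left _ _) (Real.exp_nonneg _)) ?_)
      exact add_nonneg (holderL_nonneg (n := nP P) (M := MP P) ε (.ten (embT Kr)))
        (supNormL_nonneg (n := nP P) (M := MP P) (.ten (embT Kr)))
    refine (e4G_le hn hM2 s₁ s₂ (le_max_right _ _) hδ.le hε0 hε1 h112 J hJ).trans (le_of_eq ?_)
    ring
  · intro α ε J ζ y y' hα hε0 hαε hζ hJ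
    have h113 : ∀ (Kr : Fin P.d → (Tor (fine (nP P) (MP P)) × Fin P.d → ℝ)) (y₁ w : Tor (MP P))
        (ζ₁ : Tor (fine (nP P) (MP P)) → ℝ), cutInL (nP P) (MP P) ζ₁ y₁ → suppInL (nP P) (MP P) (.ten (embT Kr)) w →
        h2L (nP P) (MP P) a (.ten (embT Kr)) α ζ₁ ≤ max (Cαε α ε) 0 * Real.exp (-(δ₀ * distSite (MP P) y₁ w))
          * cutHL (nP P) (MP P) α ζ₁
          * (holderL (nP P) (MP P) (α + ε) (.ten (embT Kr)) + supNormL (nP P) (MP P) (.ten (embT Kr))) := by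
      intro Kr y₁ w ζ₁ hc hw
      have h := H113 α ε (B5SettingP12Real.LocR.ten Kr) ζ₁ y₁ w hα hε0 hαε hc hw
      refine h.trans (mul_le_mul_of_nonneg_right (mul_le_mul_of_nonneg_right
        (mul_le_mul_of_nonneg_right (le_max_left _ _) (Real.exp_nonneg _)) (cutHL_nonneg α ζ₁)) ?_)
      exact add_nonneg (holderL_nonneg (n := nP P) (M := MP P) (α + ε) (.ten (embT Kr)))
        (supNormL_nonneg (n := nP P) (M := MP P) (.ten (embT Kr)))
    refine (h2G_le hn hM2 s₁ s₂ (le_max_right _ _) hδ.le hα hε0 hαε h113 J ζ hζ hJ).trans (le_of_eq ?_)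
    ring

end Family

end

end Literature.MathematicalPhysics.QuantumFieldTheory.Balaban1983to89.B5Remark36Derivatives
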